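import Mathlib.RingTheory.Polynomial.Hermite.Basic
import Mathlib.Probability.Distributions.Gaussian.Multivariate
import Mathlib.MeasureTheory.Integral.IntegralEqImproper
import Mathlib.MeasureTheory.Integral.Pi
import Mathlib.Analysis.Calculus.Deriv.Polynomial
import Mathlib.Analysis.SpecialFunctions.ExpDeriv
import Mathlib.Algebra.MvPolynomial.PDeriv
import Mathlib.Algebra.MvPolynomial.Equiv
import Mathlib.Algebra.MvPolynomial.Monad
import Mathlib.Topology.Algebra.MvPolynomial
import Literature.MathematicalPhysics.KineticTheory.MomentumHermiteLadder
import HarnessLib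

/-!
# Gaussian maximal correlation: `|Cov(P(ξ), Q(η))| ≤ ρ · SD(P(ξ)) · SD(Q(η))` for polynomial statistics

Topic `Literature/Probability/Distributions` (proofs file; no named fact is introduced; every statement
below is a theorem).

**Main result** (`GaussianHermite.abs_covariance_polynomial_le`). Let `(ξ, η)` be a centred Gaussian
vector with values in `ℝ^ι × ℝ^κ`, standard marginals `E ξξᵀ = 1`, `E ηηᵀ = 1`, and cross-covariance
`E ξηᵀ = K` satisfying `|uᵀ K v| ≤ ρ |u| |v|` for all `u, v` (i.e. every linear statistic of `ξ` has
correlation at most `ρ ∈ [0, 1]` with every linear statistic of `η`). Then for ALL real polynomials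
`P` on `ℝ^ι` and `Q` on `ℝ^κ`,
`|Cov(P(ξ), Q(η))| ≤ ρ · Var(P(ξ))^{1/2} · Var(Q(η))^{1/2}`:
non-linear (polynomial) statistics are never more correlated than linear ones. This is the
finite-dimensional, polynomial form of the theorem "maximal correlation = linear (canonical) correlation"
for Gaussian spaces (Kolmogorov–Rozanov 1960; Janson, *Gaussian Hilbert Spaces* (1997), Thm 10.11:
`ρ(H, K) = ρ₁(H, K) = ‖P_{HK}‖`). The pair is realised canonically as the coordinate blocks
(`xL`, `xR`) of Mathlib's `multivariateGaussian 0 [[1, K], [Kᵀ, 1]]` on `EuclideanSpace ℝ (ι ⊕ κ)`.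

Motivation in the tree: this is the estimate that upgrades two-point exponential clustering of a
Gaussian (free) Euclidean field to exponential clustering of ALL truncated Schwinger functions
`𝔖ₙ₊ₘ(θF* ⊗ T_t G) − 𝔖ₙ(θF*) 𝔖ₘ(G)` (the `HasMassGap` clause of
`Literature.MathematicalPhysics.QuantumFieldTheory.IsotropicOSFamilyExists`), with `ρ = e^{-mt}` the
one-particle bound.

## Proof (Janson 1997, proof of Thm 10.11 via the Wiener chaos, made finite-dimensional)

* **A–B.** Probabilists' Hermite polynomials `He_n` (Mathlib's `Polynomial.hermite`): `He_n' = n He_{n-1}`,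
  the three-term recursion (3.14), polynomial growth; for `N(0,1)`: integrability of polynomials and
  Stein's identity `E[x p(x)] = E[p'(x)]` (integration by parts against the density), whence the moment
  recursion.
* **C–D.** Stein's identity for the product Gaussian `N(0,1)^{⊗σ}` on multivariate polynomials (monomials
  factorise, `integral_fintype_prod_eq_prod`), then for `N(0, S) = (√S)_* N(0,1)^{⊗σ}`:
  `E[z_a G(z)] = ∑_b S_{ab} E[∂_b G(z)]` (chain rule for the linear substitution `X ↦ √S X`).
* **E.** Multivariate Hermite functionals `H_ν(z) = ∏_s He_{ν_s}(z_s)` and the cross-moment recursion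
  `M_S(ν + e_a) = ∑_b S_{ab} ν_b M_S(ν − e_b) − ν_a M_S(ν − e_a)` for `M_S(ν) = E_{N(0,S)} H_ν`.
* **F–H.** For `S = [[1, K], [Kᵀ, 1]]`: the selection rule `E[H_α(ξ) H_β(η)] = 0` unless `|α| = |β|`
  (chaoses of different order are orthogonal), the homogeneity `M_{cK}(α, β) = c^{|α|} M_K(α, β)`, and —
  through the marginal laws (`map_restrictCLM_γm`: coordinate blocks of `N(0,S)` are `N(0, S_block)`)
  and the one-dimensional orthogonality `E[He_n He_k] = n! δ_{nk}` (3.12) — the orthogonality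
  `E[H_α(ξ) H_α'(ξ)] = α! δ_{αα'}`.
* **I.** Every polynomial is a finite Hermite combination (span argument); `[[1, K], [Kᵀ, 1]] ⪰ 0` when
  `|uᵀKv| ≤ |u||v|`; Cauchy–Schwarz in discriminant form.
* **J.** With `P = ∑ c_α H_α`, `Q = ∑ d_β H_β`: `Cov = ∑_{α,β ≠ 0} c_α d_β M_K(α,β)`,
  `Var P(ξ) = ∑_{α≠0} c_α² α!`; writing `K = ρ K'` (so that `[[1,K'],[K'ᵀ,1]] ⪰ 0` too),
  `M_K(α,β) = ρ^{|α|} M_{K'}(α,β)` turns the covariance into `ρ · E'[P̃(ξ') Q'(η')]` for the comparison pair,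
  with `P̃ = ∑ ρ^{|α|-1} c_α H_α`; one Cauchy–Schwarz and `E'[P̃²] ≤ Var P(ξ)` finish.

## Sources

* S. Janson, *Gaussian Hilbert Spaces*, Cambridge Tracts in Math. 129 (1997): Ch. 10, Thm 10.11
  (maximal correlation coefficient `ρ(H,K) = ρ₁(H,K) = ‖P_{HK}‖`, proof via the chaos decomposition and
  Thm 4.9); Example 2.9 and Example 3.18 ((3.11)–(3.14): Hermite polynomials, orthogonality, product and
  recursion formulas); Thm 3.9 (expectations of products of Wick products: zero unless the orders agree);
  Thm 3.21 (`:∏ ξ_i^{α_i}: = ∏ h_{α_i}(ξ_i)` and `{(α!)^{-1/2} :ξ^α:}` is an orthonormal basis); Def. 15.130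
  and Thm 15.135 with Example 15.29 (the divergence operator: Gaussian integration by parts
  `E(ξ Z) = E(∂_ξ Z)`). [Janson1997]
* A. N. Kolmogorov, Yu. A. Rozanov, *On strong mixing conditions for stationary Gaussian processes*,
  Theory Probab. Appl. 5 (1960) 204–208 (the maximal correlation of Gaussian families equals the linear
  one) — historical attribution; the statement proved here is cited from Janson.

## What is NOT here

The `L²` (non-polynomial) statistics and infinite-dimensional Gaussian subspaces of Janson's Thm 10.11
(they follow by density of polynomials, Janson Thm 2.11, not formalised); general (non-identity) marginal
covariances (reduce to this case by choosing orthonormal bases of the spans of the coordinates).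

## Mathlib

Used: `Polynomial.hermite` (only the recursion `hermite_succ`; the orthogonality relations are proved
here), `gaussianReal`, `multivariateGaussian`, `stdGaussian_eq_map_pi`/`map_pi_eq_stdGaussian`,
`IsGaussian.ext` (Gaussian measures are determined by mean and covariance), `CFC.sqrt`,
`integral_fintype_prod_eq_prod`, `integral_mul_deriv_eq_deriv_mul_of_integrable` (integration by parts
on `ℝ`), `MvPolynomial.pderiv`/`bind₁`, `Finsupp.mem_span_range_iff_exists_finsupp`, `discrim_le_zero`.
Absent at the pin (searched): Hermite orthogonality, Mehler's formula, Wick products, hypercontractivity,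
any maximal-correlation statement.
-/

open MeasureTheory ProbabilityTheory Polynomial WithLp
open scoped MatrixOrder Matrix

noncomputable section

namespace Literature.Probability.Distributions

namespace GaussianHermite

/-! ### A. Probabilists' Hermite polynomials: derivative and three-term recursion -/

-- `derivative_hermite_succ` (`He_{n+1}' = (n+1) He_n`) and the three-term recursion
-- `hermite_succ_succ` (Janson 1997, (3.14)) are reused from
-- `Literature.MathematicalPhysics.KineticTheory.MomentumHermiteLadder` (namespace `HeatConduction`).
open Literature.MathematicalPhysics.KineticTheory.HeatConduction (derivative_hermite_succ hermite_succ_succ)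

/-- The Hermite polynomial `He_n` with real coefficients. [cite: Janson1997, Example 2.9] -/
def heP (n : ℕ) : Polynomial ℝ := (hermite n).map (Int.castRingHom ℝ)

/-- The Hermite polynomial `He_n` as a real function. [cite: Janson1997, Example 2.9] -/
def he (n : ℕ) (x : ℝ) : ℝ := (heP n).eval x

/-- `He_0 = 1`. [folklore] -/
@[simp] private theorem he_zero (x : ℝ) : he 0 x = 1 := by simp [he, heP]

/-- `He_1(x) = x`. [folklore] -/
@[simp] private theorem he_one (x : ℝ) : he 1 x = x := by simp [he, heP]

/-- `He_{n+2}(x) = x He_{n+1}(x) - (n+1) He_n(x)`. [cite: Janson1997, Example 3.18 (3.14)] -/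
theorem he_succ_succ (n : ℕ) (x : ℝ) :
    he (n + 2) x = x * he (n + 1) x - (n + 1) * he n x := by
  simp only [he, heP, hermite_succ_succ, Polynomial.map_sub, Polynomial.map_mul, map_X,
    Polynomial.map_add, Polynomial.map_natCast, Polynomial.map_one, eval_sub, eval_mul, eval_X,
    eval_add, eval_natCast, eval_one]

/-- `He_{n+1}(x) = x He_n(x) - n He_{n-1}(x)` in the form valid for all `n` (with `n He_{n-1} := 0` at `n = 0`):
`x He_n(x) = He_{n+1}(x) + n He_{n-1}(x)`. [cite: Janson1997, Example 3.18 (3.14)] -/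
theorem mul_he (n : ℕ) (x : ℝ) :
    x * he n x = he (n + 1) x + n * he (n - 1) x := by
  rcases n with _ | n
  · simp
  · rw [show n + 1 + 1 = n + 2 from rfl, he_succ_succ]
    simp

/-- `He_n' = n He_{n-1}`. [cite: Janson1997, Example 3.18] -/
theorem hasDerivAt_he (n : ℕ) (x : ℝ) : HasDerivAt (he n) (n * he (n - 1) x) x := by
  rcases n with _ | n
  · have h0 : he 0 = fun _ => (1 : ℝ) := funext he_zero
    rw [h0]
    simpa using hasDerivAt_const x (1 : ℝ)
  · have h := (heP (n + 1)).hasDerivAt x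
    have hd : (heP (n + 1)).derivative = ((n : Polynomial ℝ) + 1) * heP n := by
      simp only [heP, derivative_map, derivative_hermite_succ, Polynomial.map_mul,
        Polynomial.map_add, Polynomial.map_natCast, Polynomial.map_one]
    rw [hd, eval_mul, eval_add, eval_natCast, eval_one] at h
    have h0 : he (n + 1) = fun y => (heP (n + 1)).eval y := rfl
    rw [h0]
    simpa [he] using h

/-- Hermite polynomial functions are continuous. [folklore] -/
private theorem continuous_he (n : ℕ) : Continuous (he n) := by
  unfold he; exact (heP n).continuous

/-- Polynomial growth `|He_n(x)| ≤ C (1 + |x|)^n`. [folklore] -/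
private theorem exists_abs_he_le (n : ℕ) : ∃ C : ℝ, 0 ≤ C ∧ ∀ x, |he n x| ≤ C * (1 + |x|) ^ n := by
  induction n using Nat.strong_induction_on with
  | _ n ih =>
    rcases n with _ | _ | n
    · exact ⟨1, zero_le_one, fun x => by simp⟩
    · refine ⟨1, zero_le_one, fun x => ?_⟩
      rw [he_one, one_mul, zero_add, pow_one]
      linarith [abs_nonneg x]
    · obtain ⟨C₁, hC₁, h₁⟩ := ih (n + 1) (by omega)
      obtain ⟨C₀, hC₀, h₀⟩ := ih n (by omega)
      refine ⟨C₁ + (n + 1) * C₀, by positivity, fun x => ?_⟩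
      rw [he_succ_succ]
      have hx : 0 ≤ 1 + |x| := by positivity
      have hp1 : (1 + |x|) ^ (n + 1) ≤ (1 + |x|) ^ (n + 2) :=
        pow_le_pow_right₀ (by linarith [abs_nonneg x]) (by omega)
      have hp0 : (1 + |x|) ^ n ≤ (1 + |x|) ^ (n + 2) :=
        pow_le_pow_right₀ (by linarith [abs_nonneg x]) (by omega)
      have e1 : |x| * |he (n + 1) x| ≤ (1 + |x|) * (C₁ * (1 + |x|) ^ (n + 1)) :=
        mul_le_mul (by linarith [abs_nonneg x]) (h₁ x) (abs_nonneg _) hx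
      have e2 : ((n : ℝ) + 1) * |he n x| ≤ (n + 1) * (C₀ * (1 + |x|) ^ n) :=
        mul_le_mul_of_nonneg_left (h₀ x) (by positivity)
      have e3 : C₀ * (1 + |x|) ^ n ≤ C₀ * (1 + |x|) ^ (n + 2) := mul_le_mul_of_nonneg_left hp0 hC₀
      calc |x * he (n + 1) x - (n + 1) * he n x|
          ≤ |x * he (n + 1) x| + |(n + 1) * he n x| := abs_sub _ _
        _ = |x| * |he (n + 1) x| + (n + 1) * |he n x| := by
            rw [abs_mul, abs_mul, abs_of_nonneg (by positivity : (0 : ℝ) ≤ n + 1)]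
        _ ≤ (1 + |x|) * (C₁ * (1 + |x|) ^ (n + 1)) + (n + 1) * (C₀ * (1 + |x|) ^ (n + 2)) := by
            gcongr
            exact (h₀ x).trans e3
        _ = (C₁ + (n + 1) * C₀) * (1 + |x|) ^ (n + 2) := by ring

/-! ### B. The standard Gaussian on `ℝ`: integrability of polynomials and the Stein identity -/

/-- The standard Gaussian law `N(0,1)` on `ℝ`. [folklore] -/
abbrev γ₁ : Measure ℝ := gaussianReal 0 1

/-- `(1 + a)^N ≤ 2^N (1 + a^N)` for `a ≥ 0`. [folklore] -/
private theorem one_add_pow_le (a : ℝ) (ha : 0 ≤ a) (N : ℕ) : (1 + a) ^ N ≤ 2 ^ N * (1 + a ^ N) := by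
  rcases le_total a 1 with h | h
  · calc (1 + a) ^ N ≤ (2 : ℝ) ^ N := pow_le_pow_left₀ (by positivity) (by linarith) N
      _ ≤ 2 ^ N * (1 + a ^ N) := le_mul_of_one_le_right (by positivity) (by
          have := pow_nonneg ha N; linarith)
  · calc (1 + a) ^ N ≤ (2 * a) ^ N := pow_le_pow_left₀ (by positivity) (by linarith) N
      _ = 2 ^ N * a ^ N := mul_pow 2 a N
      _ ≤ 2 ^ N * (1 + a ^ N) := mul_le_mul_of_nonneg_left (by linarith) (by positivity)

/-- A continuous function of polynomial growth is integrable for `N(0,1)`. [folklore] -/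
private theorem integrable_gaussian_of_abs_le {f : ℝ → ℝ} (hf : Continuous f) {C : ℝ} {N : ℕ}
    (h : ∀ x, |f x| ≤ C * (1 + |x|) ^ N) : Integrable f γ₁ := by
  have hpow : Integrable (fun x : ℝ => ‖x‖ ^ N) γ₁ :=
    (memLp_id_gaussianReal (μ := 0) (v := 1) (N : NNReal)).integrable_norm_pow'
  have hg : Integrable (fun x : ℝ => C * (2 ^ N * (1 + ‖x‖ ^ N))) γ₁ :=
    (((integrable_const 1).add hpow).const_mul _).const_mul _
  refine hg.mono' hf.aestronglyMeasurable (ae_of_all _ fun x => ?_)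
  rw [Real.norm_eq_abs]
  refine (h x).trans ?_
  rcases le_or_gt 0 C with hC | hC
  · exact mul_le_mul_of_nonneg_left (by simpa using one_add_pow_le |x| (abs_nonneg x) N) hC
  · have : C * (1 + |x|) ^ N ≤ 0 := mul_nonpos_of_nonpos_of_nonneg hC.le (by positivity)
    have h2 : 0 ≤ |f x| := abs_nonneg _
    have h3 : C * (1 + |x|) ^ N = 0 := le_antisymm this (h2.trans (h x))
    have h4 : (1 + |x|) ^ N ≠ 0 := by positivity
    have : C = 0 := by
      rcases mul_eq_zero.1 h3 with h5 | h5
      · exact h5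
      · exact absurd h5 h4
    exact absurd this hC.ne

/-- Polynomial growth of polynomial functions. [folklore] -/
private theorem exists_abs_eval_le (p : Polynomial ℝ) : ∃ C : ℝ, 0 ≤ C ∧ ∀ x, |p.eval x| ≤ C * (1 + |x|) ^ p.natDegree := by
  refine ⟨∑ i ∈ Finset.range (p.natDegree + 1), |p.coeff i|, Finset.sum_nonneg fun _ _ => abs_nonneg _,
    fun x => ?_⟩
  rw [eval_eq_sum_range, Finset.sum_mul]
  refine (Finset.abs_sum_le_sum_abs _ _).trans (Finset.sum_le_sum fun i hi => ?_)
  rw [abs_mul, abs_pow]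
  refine mul_le_mul_of_nonneg_left ?_ (abs_nonneg _)
  have hi' : i ≤ p.natDegree := Nat.lt_succ_iff.1 (Finset.mem_range.1 hi)
  calc |x| ^ i ≤ (1 + |x|) ^ i := pow_le_pow_left₀ (abs_nonneg x) (by linarith [abs_nonneg x]) i
    _ ≤ (1 + |x|) ^ p.natDegree := pow_le_pow_right₀ (by linarith [abs_nonneg x]) hi'

/-- Polynomial functions are integrable for `N(0,1)`. [folklore] -/
private theorem integrable_eval_gaussian (p : Polynomial ℝ) : Integrable (fun x => p.eval x) γ₁ := by
  obtain ⟨C, -, hC⟩ := exists_abs_eval_le p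
  exact integrable_gaussian_of_abs_le p.continuous hC

/-- The density of `N(0,1)`. [folklore] -/
abbrev φ₁ (x : ℝ) : ℝ := gaussianPDFReal 0 1 x

/-- The density of `N(0,1)` is `(2π)^{-1/2} e^{-x²/2}`. [folklore] -/
theorem φ₁_eq (x : ℝ) : φ₁ x = (Real.sqrt (2 * Real.pi))⁻¹ * Real.exp (-x ^ 2 / 2) := by
  simp [φ₁, gaussianPDFReal]

/-- `φ' (x) = -x φ(x)` for the standard Gaussian density. [folklore] -/
private theorem hasDerivAt_φ₁ (x : ℝ) : HasDerivAt φ₁ (-x * φ₁ x) x := by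
  have h1 : HasDerivAt (fun y : ℝ => -y ^ 2 / 2) (-x) x := by
    have := ((hasDerivAt_pow 2 x).neg).div_const 2
    refine this.congr_deriv ?_
    push_cast
    ring
  have h2 : HasDerivAt (fun y : ℝ => (Real.sqrt (2 * Real.pi))⁻¹ * Real.exp (-y ^ 2 / 2))
      ((Real.sqrt (2 * Real.pi))⁻¹ * (Real.exp (-x ^ 2 / 2) * -x)) x :=
    (h1.exp).const_mul _
  have hφ : φ₁ = fun y : ℝ => (Real.sqrt (2 * Real.pi))⁻¹ * Real.exp (-y ^ 2 / 2) := funext φ₁_eq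
  rw [hφ]
  convert h2 using 1
  ring

/-- Transfer of integrability from `N(0,1)` to Lebesgue measure with the density. [folklore] -/
private theorem integrable_mul_φ₁ {g : ℝ → ℝ} (hg : Integrable g γ₁) : Integrable (fun x => g x * φ₁ x) := by
  have h : γ₁ = volume.withDensity (gaussianPDF 0 1) := gaussianReal_of_var_ne_zero 0 one_ne_zero
  rw [h, integrable_withDensity_iff (measurable_gaussianPDF 0 1)
    (ae_of_all _ fun _ => gaussianPDF_lt_top)] at hg
  simpa [toReal_gaussianPDF] using hg

/-- Integration against `N(0,1)` is integration against its density. [folklore] -/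
private theorem integral_γ₁_eq (g : ℝ → ℝ) : ∫ x, g x ∂γ₁ = ∫ x, g x * φ₁ x := by
  rw [integral_gaussianReal_eq_integral_smul one_ne_zero]
  refine integral_congr_ae (ae_of_all _ fun x => ?_)
  simp [φ₁, mul_comm]

/-- **Stein's identity for `N(0,1)` on polynomials**: `E[x p(x)] = E[p'(x)]` (Gaussian integration by
parts: the divergence `δ(1 ⊗ ξ) = ξ` is adjoint to the gradient, `E⟨X, ∇Z⟩ = E(δX · Z)`, Janson 1997,
Def. 15.130, Thm 15.135 with Example 15.29). [cite: Janson1997, Definition 15.130 and Theorem 15.135] -/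
theorem integral_mul_eval_gaussian (p : Polynomial ℝ) :
    ∫ x, x * p.eval x ∂γ₁ = ∫ x, p.derivative.eval x ∂γ₁ := by
  rw [integral_γ₁_eq, integral_γ₁_eq]
  have hu : ∀ x ∈ tsupport φ₁, HasDerivAt (fun y => p.eval y) (p.derivative.eval x) x :=
    fun x _ => p.hasDerivAt x
  have hv : ∀ x ∈ tsupport (fun y => p.eval y), HasDerivAt φ₁ (-x * φ₁ x) x := fun x _ => hasDerivAt_φ₁ x
  have h1 : Integrable ((fun y => p.eval y) * fun x => -x * φ₁ x) := by
    have := integrable_mul_φ₁ (integrable_eval_gaussian (-(X * p)))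
    refine this.congr (ae_of_all _ fun x => ?_)
    simp only [eval_neg, eval_mul, eval_X, Pi.mul_apply]; ring
  have h2 : Integrable ((fun x => p.derivative.eval x) * φ₁) :=
    integrable_mul_φ₁ (integrable_eval_gaussian p.derivative)
  have h3 : Integrable ((fun y => p.eval y) * φ₁) := integrable_mul_φ₁ (integrable_eval_gaussian p)
  have key := integral_mul_deriv_eq_deriv_mul_of_integrable hu hv h1 h2 h3
  have lhs : ∫ x, x * p.eval x * φ₁ x = -∫ x, p.eval x * (-x * φ₁ x) := by
    rw [← integral_neg]; congr 1; funext x; ring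
  rw [lhs, key, neg_neg]

/-- Moments recursion `E[x^{k+2}] = (k+1) E[x^k]` for `N(0,1)` (Stein's identity on `x^{k+1}`).
[cite: Janson1997, Definition 15.130 and Theorem 15.135] -/
theorem integral_pow_succ_succ_gaussian (k : ℕ) :
    ∫ x, x ^ (k + 2) ∂γ₁ = (k + 1) * ∫ x, x ^ k ∂γ₁ := by
  have h := integral_mul_eval_gaussian (X ^ (k + 1))
  simp only [eval_pow, eval_X, derivative_X_pow, Nat.cast_add, Nat.cast_one, add_tsub_cancel_right,
    eval_mul] at h
  have e1 : ∫ x, x ^ (k + 2) ∂γ₁ = ∫ x, x * x ^ (k + 1) ∂γ₁ := by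
    congr 1; funext x; ring
  rw [e1, h]
  have e2 : (fun x : ℝ => eval x (C ((k : ℝ) + 1)) * x ^ k) = fun x => ((k : ℝ) + 1) * x ^ k := by
    funext x; simp
  rw [e2, integral_const_mul]

/-- `E[x] = 0` for `N(0,1)`. [folklore] -/
private theorem integral_pow_one_gaussian : ∫ x, x ^ 1 ∂γ₁ = 0 := by
  simp [integral_id_gaussianReal]

/-- `E[1] = 1` for `N(0,1)`. [folklore] -/
private theorem integral_pow_zero_gaussian : ∫ x, x ^ 0 ∂γ₁ = 1 := by
  simp

/-! ### C. The product Gaussian `N(0,1)^σ`: integrability and the Stein identity for polynomials -/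

section Pi

variable {σ : Type*} [Fintype σ]

/-- The product measure `N(0,1)^{⊗σ}` on `σ → ℝ`. [folklore] -/
abbrev γπ (σ : Type*) [Fintype σ] : Measure (σ → ℝ) := Measure.pi fun _ : σ => γ₁

/-- Monomials are integrable for the product Gaussian. [folklore] -/
private theorem integrable_monomial_pi (ν : σ → ℕ) :
    Integrable (fun x : σ → ℝ => ∏ s, x s ^ ν s) (γπ σ) :=
  Integrable.fintype_prod (f := fun s (t : ℝ) => t ^ ν s)
    fun s => by simpa using integrable_eval_gaussian (X ^ ν s)

/-- Evaluation of a monomial as a product over all coordinates. [folklore] -/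
private theorem eval_monomial_eq (ν : σ →₀ ℕ) (a : ℝ) (x : σ → ℝ) :
    MvPolynomial.eval x (MvPolynomial.monomial ν a) = a * ∏ s, x s ^ ν s := by
  rw [MvPolynomial.eval_monomial, Finsupp.prod_fintype]
  intro s; simp

/-- Polynomial functions are integrable for the product Gaussian. [folklore] -/
private theorem integrable_eval_pi (H : MvPolynomial σ ℝ) :
    Integrable (fun x : σ → ℝ => MvPolynomial.eval x H) (γπ σ) := by
  induction H using MvPolynomial.induction_on' with
  | monomial ν a =>
    simp_rw [eval_monomial_eq]
    exact (integrable_monomial_pi _).const_mul a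
  | add p q hp hq =>
    simp_rw [map_add]
    exact hp.add hq

/-- Integral of a monomial: product of one-dimensional moments. [folklore] -/
private theorem integral_monomial_pi (ν : σ → ℕ) :
    ∫ x, ∏ s, x s ^ ν s ∂(γπ σ) = ∏ s, ∫ t, t ^ ν s ∂γ₁ :=
  integral_fintype_prod_eq_prod (𝕜 := ℝ) (fun s (t : ℝ) => t ^ ν s)

/-- One-dimensional Stein identity on monomials, in the form `E[x^{n+1}] = n E[x^{n-1}]`
(`n E[x^{n-1}] := 0` at `n = 0`). [cite: Janson1997, Definition 15.130 and Theorem 15.135] -/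
theorem integral_pow_succ_gaussian (n : ℕ) :
    ∫ t, t ^ (n + 1) ∂γ₁ = n * ∫ t, t ^ (n - 1) ∂γ₁ := by
  rcases n with _ | n
  · simp [integral_id_gaussianReal]
  · rw [show n + 1 + 1 = n + 2 from rfl, integral_pow_succ_succ_gaussian]
    simp

/-- **Stein identity for `N(0,1)^{⊗σ}` on polynomials**: `E[x_c H(x)] = E[∂_c H(x)]` (Gaussian
integration by parts on `ℝ^σ` with the standard Gaussian measure, Janson 1997 Example 15.29 with
Def. 15.130/Thm 15.135: `E(ξ_c Z) = E(∂_{ξ_c} Z)` for polynomial `Z`).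
[cite: Janson1997, Definition 15.130 and Theorem 15.135] -/
theorem integral_coord_mul_eval_pi [DecidableEq σ] (H : MvPolynomial σ ℝ) (c : σ) :
    ∫ x, x c * MvPolynomial.eval x H ∂(γπ σ) =
      ∫ x, MvPolynomial.eval x (MvPolynomial.pderiv c H) ∂(γπ σ) := by
  induction H using MvPolynomial.induction_on' with
  | monomial ν a =>
    rw [MvPolynomial.pderiv_monomial]
    simp_rw [eval_monomial_eq]
    -- left side: `x c * (a * ∏ x s ^ ν s) = a * ∏ s, x s ^ (ν s + [s = c])`
    have hl : ∀ x : σ → ℝ, x c * (a * ∏ s, x s ^ ν s) =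
        a * ∏ s, x s ^ (ν + Finsupp.single c 1 : σ →₀ ℕ) s := by
      intro x
      have : ∏ s, x s ^ (ν + Finsupp.single c 1 : σ →₀ ℕ) s = x c * ∏ s, x s ^ ν s := by
        rw [← Finset.mul_prod_erase Finset.univ _ (Finset.mem_univ c),
          ← Finset.mul_prod_erase Finset.univ (fun s => x s ^ ν s) (Finset.mem_univ c)]
        have h1 : ∏ s ∈ Finset.univ.erase c, x s ^ (ν + Finsupp.single c 1 : σ →₀ ℕ) s =
            ∏ s ∈ Finset.univ.erase c, x s ^ ν s := by
          refine Finset.prod_congr rfl fun s hs => ?_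
          have hsc : s ≠ c := Finset.ne_of_mem_erase hs
          simp [hsc.symm]
        rw [h1, Finsupp.add_apply, Finsupp.single_eq_same, pow_succ]
        ring
      rw [this]; ring
    simp_rw [hl, integral_const_mul, integral_monomial_pi]
    -- compare the two products of moments
    rcases Nat.eq_zero_or_pos (ν c) with h0 | hpos
    · -- `ν c = 0`: both sides vanish
      have hL : ∏ s, ∫ t, t ^ (ν + Finsupp.single c 1 : σ →₀ ℕ) s ∂γ₁ = 0 := by
        refine Finset.prod_eq_zero (Finset.mem_univ c) ?_
        simp [h0, integral_id_gaussianReal]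
      rw [hL, h0]; simp
    · have hR : ∏ s, ∫ t, t ^ (ν - Finsupp.single c 1 : σ →₀ ℕ) s ∂γ₁ =
          (∫ t, t ^ (ν c - 1) ∂γ₁) * ∏ s ∈ Finset.univ.erase c, ∫ t, t ^ ν s ∂γ₁ := by
        rw [← Finset.mul_prod_erase Finset.univ _ (Finset.mem_univ c)]
        congr 1
        · simp
        · refine Finset.prod_congr rfl fun s hs => ?_
          have hsc : s ≠ c := Finset.ne_of_mem_erase hs
          simp [hsc.symm]
      have hL : ∏ s, ∫ t, t ^ (ν + Finsupp.single c 1 : σ →₀ ℕ) s ∂γ₁ =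
          (∫ t, t ^ (ν c + 1) ∂γ₁) * ∏ s ∈ Finset.univ.erase c, ∫ t, t ^ ν s ∂γ₁ := by
        rw [← Finset.mul_prod_erase Finset.univ _ (Finset.mem_univ c)]
        congr 1
        · simp
        · refine Finset.prod_congr rfl fun s hs => ?_
          have hsc : s ≠ c := Finset.ne_of_mem_erase hs
          simp [hsc.symm]
      rw [hL, hR, integral_pow_succ_gaussian]
      ring
  | add p q hp hq =>
    simp_rw [map_add, mul_add]
    rw [integral_add, integral_add (integrable_eval_pi _) (integrable_eval_pi _), hp, hq]
    · exact (integrable_eval_pi (MvPolynomial.X c * p)).congr (ae_of_all _ fun x => by simp)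
    · exact (integrable_eval_pi (MvPolynomial.X c * q)).congr (ae_of_all _ fun x => by simp)

end Pi


/-! ### D. Multivariate Gaussians `N(0,S)`: transport to the product Gaussian and the Stein identity -/

section Multivariate

variable {σ : Type*} [Fintype σ] [DecidableEq σ]

/-- The centred multivariate Gaussian `N(0,S)` on `EuclideanSpace ℝ σ` (Mathlib's
`multivariateGaussian`). [folklore] -/
abbrev γm (S : Matrix σ σ ℝ) : Measure (EuclideanSpace ℝ σ) := multivariateGaussian 0 S

/-- `N(0,S)` is the image of `N(0,1)^{⊗σ}` under `x ↦ √S x`. [folklore] -/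
theorem γm_eq_map (S : Matrix σ σ ℝ) :
    γm S = (γπ σ).map (fun x : σ → ℝ => toLp 2 (CFC.sqrt S *ᵥ x)) := by
  unfold γm multivariateGaussian
  rw [← map_pi_eq_stdGaussian, Measure.map_map (by fun_prop) (by fun_prop)]
  congr 1
  funext x
  simp

/-- Transport of integrals from `N(0,S)` to `N(0,1)^{⊗σ}`. [folklore] -/
private theorem integral_γm_eq (S : Matrix σ σ ℝ) {Φ : EuclideanSpace ℝ σ → ℝ} (hΦ : Measurable Φ) :
    ∫ z, Φ z ∂γm S = ∫ x, Φ (toLp 2 (CFC.sqrt S *ᵥ x)) ∂γπ σ := by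
  rw [γm_eq_map, integral_map (by fun_prop) hΦ.aestronglyMeasurable]

/-- The linear substitution `X_s ↦ ∑_c R_{sc} X_c`. [folklore] -/
def linSubst (R : Matrix σ σ ℝ) (s : σ) : MvPolynomial σ ℝ := ∑ c, MvPolynomial.C (R s c) * MvPolynomial.X c

omit [DecidableEq σ] in
/-- Evaluating the linear substitution gives the matrix action. [folklore] -/
private theorem eval_linSubst (R : Matrix σ σ ℝ) (x : σ → ℝ) (s : σ) :
    MvPolynomial.eval x (linSubst R s) = (R *ᵥ x) s := by
  simp [linSubst, Matrix.mulVec, dotProduct]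

omit [DecidableEq σ] in
/-- Evaluating a substituted polynomial is evaluating at the image point. [folklore] -/
private theorem eval_bind₁_linSubst (R : Matrix σ σ ℝ) (G : MvPolynomial σ ℝ) (x : σ → ℝ) :
    MvPolynomial.eval x (MvPolynomial.bind₁ (linSubst R) G) = MvPolynomial.eval (R *ᵥ x) G := by
  have hfun : (fun i => MvPolynomial.eval x (linSubst R i)) = R *ᵥ x := funext (eval_linSubst R x)
  calc MvPolynomial.eval x (MvPolynomial.bind₁ (linSubst R) G)
      = MvPolynomial.aeval x (MvPolynomial.bind₁ (linSubst R) G) := rfl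
    _ = MvPolynomial.aeval (fun i => MvPolynomial.aeval x (linSubst R i)) G :=
        MvPolynomial.aeval_bind₁ _ _ _
    _ = MvPolynomial.eval (fun i => MvPolynomial.eval x (linSubst R i)) G := rfl
    _ = MvPolynomial.eval (R *ᵥ x) G := by rw [hfun]

/-- Partial derivatives of the linear forms. [folklore] -/
private theorem pderiv_linSubst (R : Matrix σ σ ℝ) (s c : σ) :
    MvPolynomial.pderiv c (linSubst R s) = MvPolynomial.C (R s c) := by
  simp only [linSubst, map_sum, Derivation.leibniz, MvPolynomial.pderiv_C,
    MvPolynomial.pderiv_X, smul_eq_mul]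
  rw [Finset.sum_eq_single c]
  · simp
  · intro b _ hb; simp [hb]
  · intro h; exact absurd (Finset.mem_univ c) h

/-- Chain rule for the linear substitution. [folklore] -/
private theorem pderiv_bind₁_linSubst (R : Matrix σ σ ℝ) (G : MvPolynomial σ ℝ) (c : σ) :
    MvPolynomial.pderiv c (MvPolynomial.bind₁ (linSubst R) G) =
      ∑ s, MvPolynomial.C (R s c) * MvPolynomial.bind₁ (linSubst R) (MvPolynomial.pderiv s G) := by
  induction G using MvPolynomial.induction_on with
  | C a => simp
  | add p q hp hq => simp only [map_add, hp, hq, mul_add, Finset.sum_add_distrib]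
  | mul_X p n hp =>
    have h1 : ∀ s, MvPolynomial.bind₁ (linSubst R) (MvPolynomial.pderiv s (p * MvPolynomial.X n)) =
        MvPolynomial.bind₁ (linSubst R) p * (if s = n then 1 else 0) +
          linSubst R n * MvPolynomial.bind₁ (linSubst R) (MvPolynomial.pderiv s p) := by
      intro s
      rw [Derivation.leibniz, MvPolynomial.pderiv_X, smul_eq_mul, smul_eq_mul, map_add, map_mul,
        map_mul, MvPolynomial.bind₁_X_right]
      by_cases h : s = n
      · subst h; simp
      · simp [Ne.symm h, h]
    simp_rw [h1, mul_add, Finset.sum_add_distrib]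
    rw [map_mul, MvPolynomial.bind₁_X_right, Derivation.leibniz, smul_eq_mul, smul_eq_mul, hp,
      pderiv_linSubst]
    congr 1
    · simp [mul_comm]
    · rw [Finset.mul_sum]
      exact Finset.sum_congr rfl fun s _ => by ring

omit [DecidableEq σ] in
/-- Polynomial functions of the coordinates are measurable. [folklore] -/
private theorem measurable_eval_ofLp (H : MvPolynomial σ ℝ) :
    Measurable fun z : EuclideanSpace ℝ σ => MvPolynomial.eval (ofLp z) H :=
  ((MvPolynomial.continuous_eval H).comp (PiLp.continuous_ofLp 2 _)).measurable

/-- Polynomial functions of the coordinates are integrable for `N(0,S)`. [folklore] -/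
private theorem integrable_eval_γm (S : Matrix σ σ ℝ) (G : MvPolynomial σ ℝ) :
    Integrable (fun z : EuclideanSpace ℝ σ => MvPolynomial.eval (ofLp z) G) (γm S) := by
  rw [γm_eq_map]
  refine ((integrable_map_measure (measurable_eval_ofLp G).aestronglyMeasurable (by fun_prop)).2 ?_)
  · simp only [Function.comp_def]
    simpa [eval_bind₁_linSubst] using integrable_eval_pi (MvPolynomial.bind₁ (linSubst (CFC.sqrt S)) G)

/-- `√S (√S)ᵀ = S` for a positive semidefinite real matrix. [folklore] -/
private theorem sqrt_mul_sqrt_transpose {S : Matrix σ σ ℝ} (hS : S.PosSemidef) :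
    CFC.sqrt S * (CFC.sqrt S)ᵀ = S := by
  have h1 : (CFC.sqrt S)ᵀ = CFC.sqrt S := by
    have := (CFC.sqrt_nonneg S).isSelfAdjoint
    rw [IsSelfAdjoint, Matrix.star_eq_conjTranspose, Matrix.conjTranspose_eq_transpose_of_trivial] at this
    exact this
  rw [h1]
  exact CFC.sqrt_mul_sqrt_self S hS.nonneg

/-- **Stein identity (Gaussian integration by parts) for `N(0,S)` on polynomials**:
`E[z_a G(z)] = ∑_b S_{ab} E[∂_b G(z)]` (`E(ξ Z) = E(∂_ξ Z)` with `∂_ξ = ⟨∇Z, ξ⟩_H` and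
`⟨z_a, z_b⟩_H = S_{ab}`). [cite: Janson1997, Definition 15.130 and Theorem 15.135] -/
theorem integral_coord_mul_eval_γm {S : Matrix σ σ ℝ} (hS : S.PosSemidef) (G : MvPolynomial σ ℝ) (a : σ) :
    ∫ z, z a * MvPolynomial.eval (ofLp z) G ∂γm S =
      ∑ b, S a b * ∫ z, MvPolynomial.eval (ofLp z) (MvPolynomial.pderiv b G) ∂γm S := by
  have hm1 : Measurable (fun z : EuclideanSpace ℝ σ => z a * MvPolynomial.eval (ofLp z) G) :=
    ((measurable_pi_apply a).comp (PiLp.continuous_ofLp 2 _).measurable).mul (measurable_eval_ofLp G)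
  rw [integral_γm_eq S hm1]
  simp_rw [integral_γm_eq S (measurable_eval_ofLp _)]
  -- rewrite through the substituted polynomial
  have h1 : ∀ x : σ → ℝ, (CFC.sqrt S *ᵥ x) a * MvPolynomial.eval (CFC.sqrt S *ᵥ x) G =
      ∑ c, CFC.sqrt S a c *
        (x c * MvPolynomial.eval x (MvPolynomial.bind₁ (linSubst (CFC.sqrt S)) G)) := by
    intro x
    rw [eval_bind₁_linSubst, Matrix.mulVec, dotProduct, Finset.sum_mul]
    exact Finset.sum_congr rfl fun c _ => by ring
  simp_rw [h1]
  rw [integral_finsetSum _ fun c _ => ?_]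
  swap
  · refine Integrable.const_mul ?_ _
    exact (integrable_eval_pi (MvPolynomial.X c * MvPolynomial.bind₁ (linSubst (CFC.sqrt S)) G)).congr
      (ae_of_all _ fun x => by simp)
  simp_rw [integral_const_mul, integral_coord_mul_eval_pi, pderiv_bind₁_linSubst, map_sum, map_mul,
    MvPolynomial.eval_C, eval_bind₁_linSubst]
  have h2 : ∀ c, ∫ x, ∑ s, CFC.sqrt S s c *
        MvPolynomial.eval (CFC.sqrt S *ᵥ x) (MvPolynomial.pderiv s G) ∂γπ σ =
      ∑ s, CFC.sqrt S s c * ∫ x, MvPolynomial.eval (CFC.sqrt S *ᵥ x) (MvPolynomial.pderiv s G) ∂γπ σ := by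
    intro c
    rw [integral_finsetSum _ fun s _ => ?_]
    · simp_rw [integral_const_mul]
    · refine Integrable.const_mul ?_ _
      simpa [eval_bind₁_linSubst] using
        integrable_eval_pi (MvPolynomial.bind₁ (linSubst (CFC.sqrt S)) (MvPolynomial.pderiv s G))
  simp_rw [h2, Finset.mul_sum]
  rw [Finset.sum_comm]
  refine Finset.sum_congr rfl fun s _ => ?_
  simp_rw [← mul_assoc, ← Finset.sum_mul]
  congr 1
  have := congrArg (fun M : Matrix σ σ ℝ => M a s) (sqrt_mul_sqrt_transpose hS)
  simpa [Matrix.mul_apply] using this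

end Multivariate

/-! ### E. Multivariate Hermite functionals and the cross-moment recursion -/

section Hermite

variable {σ : Type*} [Fintype σ] [DecidableEq σ]

/-- The multivariate Hermite functional `H_ν(x) = ∏_s He_{ν_s}(x_s)` (a Wick product of coordinates
of a standard Gaussian vector, Janson 1997, Thm 3.19–3.21). [cite: Janson1997, Theorem 3.21] -/
def hf (ν : σ → ℕ) (x : σ → ℝ) : ℝ := ∏ s, he (ν s) (x s)

/-- `H_ν` as a multivariate polynomial. [cite: Janson1997, Theorem 3.21] -/
def hP (ν : σ → ℕ) : MvPolynomial σ ℝ := ∏ s, Polynomial.toMvPolynomial s (heP (ν s))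

omit [DecidableEq σ] in
/-- The polynomial `hP ν` evaluates to the Hermite functional `H_ν`. [folklore] -/
private theorem eval_hP (ν : σ → ℕ) (x : σ → ℝ) : MvPolynomial.eval x (hP ν) = hf ν x := by
  simp [hP, hf, map_prod, MvPolynomial.eval_toMvPolynomial, he]

omit [DecidableEq σ] in
/-- `H_0 = 1`. [folklore] -/
@[simp] private theorem hf_zero (x : σ → ℝ) : hf 0 x = 1 := by simp [hf]

/-- `He_n' = n He_{n-1}` with real coefficients. [cite: Janson1997, Example 3.18] -/
theorem derivative_heP (n : ℕ) : (heP n).derivative = Polynomial.C (n : ℝ) * heP (n - 1) := by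
  rcases n with _ | n
  · simp [heP]
  · simp only [heP, derivative_map, derivative_hermite_succ, Polynomial.map_mul, Polynomial.map_add,
      Polynomial.map_natCast, Polynomial.map_one, Nat.cast_succ, add_tsub_cancel_right, map_add,
      map_natCast, map_one]

/-- A derivation killing every factor kills the product. [folklore] -/
private theorem derivation_prod_eq_zero {ι A : Type*} [CommRing A] [Algebra ℝ A]
    (D : Derivation ℝ A A) (s : Finset ι) (q : ι → A) (h : ∀ i ∈ s, D (q i) = 0) :
    D (∏ i ∈ s, q i) = 0 := by
  classical
  induction s using Finset.induction_on with
  | empty => simp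
  | insert a s ha ih =>
    rw [Finset.prod_insert ha, Derivation.leibniz, ih fun i hi => h i (Finset.mem_insert_of_mem hi),
      h a (Finset.mem_insert_self a s), smul_zero, smul_zero, add_zero]

/-- `∂_b H_ν = ν_b H_{ν - e_b}`. [cite: Janson1997, Example 3.18] -/
theorem pderiv_hP (ν : σ → ℕ) (b : σ) :
    MvPolynomial.pderiv b (hP ν) = MvPolynomial.C (ν b : ℝ) * hP (ν - Pi.single b 1) := by
  have hL : hP ν = Polynomial.toMvPolynomial b (heP (ν b)) *
      ∏ s ∈ Finset.univ.erase b, Polynomial.toMvPolynomial s (heP (ν s)) :=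
    (Finset.mul_prod_erase Finset.univ (fun s => Polynomial.toMvPolynomial s (heP (ν s)))
      (Finset.mem_univ b)).symm
  have hR : hP (ν - Pi.single b 1) = Polynomial.toMvPolynomial b (heP (ν b - 1)) *
      ∏ s ∈ Finset.univ.erase b, Polynomial.toMvPolynomial s (heP (ν s)) := by
    unfold hP
    rw [← Finset.mul_prod_erase Finset.univ _ (Finset.mem_univ b)]
    congr 1
    · simp
    · refine Finset.prod_congr rfl fun s hs => ?_
      have hsb : s ≠ b := Finset.ne_of_mem_erase hs
      simp [hsb]
  have h0 : MvPolynomial.pderiv b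
      (∏ s ∈ Finset.univ.erase b, Polynomial.toMvPolynomial s (heP (ν s))) = 0 := by
    refine derivation_prod_eq_zero _ _ _ fun s hs => ?_
    have hsb : s ≠ b := Finset.ne_of_mem_erase hs
    change MvPolynomial.pderiv b (Polynomial.aeval (MvPolynomial.X s) (heP (ν s))) = 0
    rw [Derivation.map_aeval, MvPolynomial.pderiv_X]
    simp [hsb.symm]
  have h1 : MvPolynomial.pderiv b (Polynomial.toMvPolynomial b (heP (ν b))) =
      MvPolynomial.C (ν b : ℝ) * Polynomial.toMvPolynomial b (heP (ν b - 1)) := by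
    change MvPolynomial.pderiv b (Polynomial.aeval (MvPolynomial.X b) (heP (ν b))) = _
    rw [Derivation.map_aeval, MvPolynomial.pderiv_X, derivative_heP, map_mul]
    simp [Polynomial.toMvPolynomial]
  rw [hL, hR, Derivation.leibniz, smul_eq_mul, smul_eq_mul, h0, h1, mul_zero, zero_add]
  ring

omit [DecidableEq σ] in
/-- Splitting off one coordinate of `H_ν`. [folklore] -/
private theorem hf_split (ν : σ → ℕ) (x : σ → ℝ) (a : σ) [DecidableEq σ] :
    hf ν x = he (ν a) (x a) * ∏ s ∈ Finset.univ.erase a, he (ν s) (x s) :=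
  (Finset.mul_prod_erase Finset.univ (fun s => he (ν s) (x s)) (Finset.mem_univ a)).symm

/-- `x_a H_ν(x) = H_{ν+e_a}(x) + ν_a H_{ν-e_a}(x)`. [cite: Janson1997, Example 3.18 (3.14)] -/
theorem coord_mul_hf (ν : σ → ℕ) (x : σ → ℝ) (a : σ) :
    x a * hf ν x = hf (ν + Pi.single a 1) x + ν a * hf (ν - Pi.single a 1) x := by
  rw [hf_split ν x a, hf_split (ν + Pi.single a 1) x a, hf_split (ν - Pi.single a 1) x a]
  have h1 : ∏ s ∈ Finset.univ.erase a, he ((ν + Pi.single a 1 : σ → ℕ) s) (x s) =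
      ∏ s ∈ Finset.univ.erase a, he (ν s) (x s) :=
    Finset.prod_congr rfl fun s hs => by simp [Finset.ne_of_mem_erase hs]
  have h2 : ∏ s ∈ Finset.univ.erase a, he ((ν - Pi.single a 1 : σ → ℕ) s) (x s) =
      ∏ s ∈ Finset.univ.erase a, he (ν s) (x s) :=
    Finset.prod_congr rfl fun s hs => by simp [Finset.ne_of_mem_erase hs]
  rw [h1, h2]
  simp only [Pi.add_apply, Pi.sub_apply, Pi.single_eq_same]
  rw [← mul_assoc, mul_he (ν a) (x a)]
  ring

/-- The Gaussian moment `M_S(ν) = E_{N(0,S)}[H_ν]`. [cite: Janson1997, Theorem 3.9] -/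
def M (S : Matrix σ σ ℝ) (ν : σ → ℕ) : ℝ := ∫ z, hf ν (ofLp z) ∂γm S

/-- Hermite functionals are integrable for `N(0,S)`. [folklore] -/
private theorem integrable_hf (S : Matrix σ σ ℝ) (ν : σ → ℕ) :
    Integrable (fun z : EuclideanSpace ℝ σ => hf ν (ofLp z)) (γm S) := by
  simpa [eval_hP] using integrable_eval_γm S (hP ν)

/-- `M_S(0) = 1`. [folklore] -/
@[simp] private theorem M_zero (S : Matrix σ σ ℝ) : M S 0 = 1 := by simp [M]

/-- **Cross-moment recursion** (Gaussian integration by parts on Wick/Hermite products):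
`M_S(ν + e_a) = ∑_b (S - 1)_{ab} ν_b M_S(ν - e_b)`. [cite: Janson1997, Theorem 3.9] -/
theorem M_succ {S : Matrix σ σ ℝ} (hS : S.PosSemidef) (ν : σ → ℕ) (a : σ) :
    M S (ν + Pi.single a 1) =
      (∑ b, S a b * (ν b * M S (ν - Pi.single b 1))) - ν a * M S (ν - Pi.single a 1) := by
  have hrec : ∀ z : EuclideanSpace ℝ σ, hf (ν + Pi.single a 1) (ofLp z) =
      z a * hf ν (ofLp z) - ν a * hf (ν - Pi.single a 1) (ofLp z) := by
    intro z; rw [coord_mul_hf]; ring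
  unfold M
  simp_rw [hrec]
  rw [integral_sub, integral_const_mul]
  rotate_left
  · have := (integrable_eval_γm S (MvPolynomial.X a * hP ν))
    exact this.congr (ae_of_all _ fun z => by simp [eval_hP])
  · exact (integrable_hf S _).const_mul _
  have hstein := integral_coord_mul_eval_γm hS (hP ν) a
  simp_rw [eval_hP, pderiv_hP, map_mul, MvPolynomial.eval_C, eval_hP, integral_const_mul] at hstein
  rw [hstein]

end Hermite

/-! ### F. One-dimensional orthogonality `E[He_n He_k] = n! δ_{nk}` -/

section Orthogonality

/-- The recursion `J(n+1,k+1) = (k+1) J(n,k)` hidden in (3.12): from Stein's identity. [cite: Janson1997, Example 3.18] -/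
private theorem integral_he_succ_mul_he (n k : ℕ) :
    ∫ x, he (n + 1) x * he k x ∂γ₁ = k * ∫ x, he n x * he (k - 1) x ∂γ₁ := by
  -- `x He_n He_k = He_{n+1} He_k + n He_{n-1} He_k` and `E[x He_n He_k] = E[(He_n He_k)']`
  have hstein := integral_mul_eval_gaussian (heP n * heP k)
  simp only [derivative_mul, derivative_heP, eval_mul, eval_add, eval_C] at hstein
  have h1 : ∀ x : ℝ, x * (he n x * he k x) = he (n + 1) x * he k x + n * (he (n - 1) x * he k x) := by
    intro x; rw [← mul_assoc, mul_he]; ring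
  have h1' : ∀ x : ℝ, x * ((heP n).eval x * (heP k).eval x) =
      he (n + 1) x * he k x + n * (he (n - 1) x * he k x) := fun x => h1 x
  simp_rw [h1'] at hstein
  have h2 : ∀ x : ℝ, (n : ℝ) * (heP (n - 1)).eval x * (heP k).eval x +
      (heP n).eval x * ((k : ℝ) * (heP (k - 1)).eval x) =
      n * (he (n - 1) x * he k x) + k * (he n x * he (k - 1) x) := by
    intro x; simp only [he]; ring
  simp_rw [h2] at hstein
  have hi : ∀ a b : ℕ, Integrable (fun x => he a x * he b x) γ₁ := fun a b => by
    simpa [he, eval_mul] using integrable_eval_gaussian (heP a * heP b)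
  rw [integral_add ((hi _ _)) ((hi _ _).const_mul _), integral_add ((hi _ _).const_mul _)
    ((hi _ _).const_mul _)] at hstein
  simp only [integral_const_mul] at hstein
  linarith

/-- **Orthogonality of the Hermite polynomials for `N(0,1)`** (Janson 1997, (3.12)):
`∫ He_n He_k dγ = n! δ_{nk}`. [cite: Janson1997, Example 3.18 (3.12)] -/
theorem integral_he_mul_he (n k : ℕ) :
    ∫ x, he n x * he k x ∂γ₁ = if n = k then (n.factorial : ℝ) else 0 := by
  induction n generalizing k with
  | zero =>
    rcases k with _ | k
    · simp
    · have h := integral_he_succ_mul_he k 0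
      simp only [CharP.cast_eq_zero, zero_mul, he_zero, mul_one] at h
      have h' : ∫ x, he 0 x * he (k + 1) x ∂γ₁ = 0 := by simpa [he_zero] using h
      rw [h']; simp
  | succ n ih =>
    rcases k with _ | k
    · have h := integral_he_succ_mul_he n 0
      simp only [CharP.cast_eq_zero, zero_mul] at h
      rw [h]; simp
    · rw [integral_he_succ_mul_he, Nat.add_sub_cancel, ih k]
      by_cases hnk : n = k
      · subst hnk; simp [Nat.factorial_succ]
      · simp [hnk]

end Orthogonality

/-! ### G. Block structure: the pair `(ξ, η)` with `Cov = [[1, K], [Kᵀ, 1]]` -/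

section Block

variable {ι κ : Type*} [Fintype ι] [Fintype κ] [DecidableEq ι] [DecidableEq κ]

/-- The covariance matrix `[[1, K], [Kᵀ, 1]]` of a pair of standard Gaussian vectors with
cross-covariance `K`. [cite: Janson1997, Chapter 10 §1] -/
def SK (K : Matrix ι κ ℝ) : Matrix (ι ⊕ κ) (ι ⊕ κ) ℝ := Matrix.fromBlocks 1 K Kᵀ 1

/-- The cross moments `M_K(α, β) = E[H_α(ξ) H_β(η)]`. [cite: Janson1997, Theorem 3.9] -/
def MK (K : Matrix ι κ ℝ) (α : ι → ℕ) (β : κ → ℕ) : ℝ := M (SK K) (Sum.elim α β)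

/-- Total degree of a multi-index. [folklore] -/
def deg {τ : Type*} [Fintype τ] (α : τ → ℕ) : ℕ := ∑ t, α t

omit [Fintype ι] [Fintype κ] in
/-- Index bookkeeping: `(α, β) + e_{inl i} = (α + e_i, β)`. [folklore] -/
private theorem sum_elim_add_single_inl (α : ι → ℕ) (β : κ → ℕ) (i : ι) :
    Sum.elim α β + Pi.single (Sum.inl i) 1 = Sum.elim (α + Pi.single i 1) β := by
  funext s; rcases s with s | s
  · by_cases h : s = i
    · subst h; simp
    · simp [h]
  · simp

omit [Fintype ι] [Fintype κ] in
/-- Index bookkeeping: `(α, β) - e_{inl i} = (α - e_i, β)`. [folklore] -/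
private theorem sum_elim_sub_single_inl (α : ι → ℕ) (β : κ → ℕ) (i : ι) :
    Sum.elim α β - Pi.single (Sum.inl i) 1 = Sum.elim (α - Pi.single i 1) β := by
  funext s; rcases s with s | s
  · by_cases h : s = i
    · subst h; simp
    · simp [h]
  · simp

omit [Fintype ι] [Fintype κ] in
/-- Index bookkeeping: `(α, β) + e_{inr j} = (α, β + e_j)`. [folklore] -/
private theorem sum_elim_add_single_inr (α : ι → ℕ) (β : κ → ℕ) (j : κ) :
    Sum.elim α β + Pi.single (Sum.inr j) 1 = Sum.elim α (β + Pi.single j 1) := by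
  funext s; rcases s with s | s
  · simp
  · by_cases h : s = j
    · subst h; simp
    · simp [h]

omit [Fintype ι] [Fintype κ] in
/-- Index bookkeeping: `(α, β) - e_{inr j} = (α, β - e_j)`. [folklore] -/
private theorem sum_elim_sub_single_inr (α : ι → ℕ) (β : κ → ℕ) (j : κ) :
    Sum.elim α β - Pi.single (Sum.inr j) 1 = Sum.elim α (β - Pi.single j 1) := by
  funext s; rcases s with s | s
  · simp
  · by_cases h : s = j
    · subst h; simp
    · simp [h]

/-- Recursion in the `ξ`-index: `M_K(α + e_i, β) = ∑_j K_{ij} β_j M_K(α, β - e_j)`.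
[cite: Janson1997, Theorem 3.9] -/
theorem MK_succ_inl {K : Matrix ι κ ℝ} (hS : (SK K).PosSemidef) (α : ι → ℕ) (β : κ → ℕ) (i : ι) :
    MK K (α + Pi.single i 1) β = ∑ j, K i j * (β j * MK K α (β - Pi.single j 1)) := by
  unfold MK
  rw [← sum_elim_add_single_inl, M_succ hS, Fintype.sum_sum_type]
  simp only [SK, Matrix.fromBlocks_apply₁₁, Matrix.fromBlocks_apply₁₂, Sum.elim_inl, Sum.elim_inr,
    sum_elim_sub_single_inl, sum_elim_sub_single_inr, Matrix.one_apply, ite_mul, one_mul, zero_mul,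
    Finset.sum_ite_eq, Finset.mem_univ, if_true]
  ring

/-- Recursion in the `η`-index: `M_K(α, β + e_j) = ∑_i K_{ij} α_i M_K(α - e_i, β)`.
[cite: Janson1997, Theorem 3.9] -/
theorem MK_succ_inr {K : Matrix ι κ ℝ} (hS : (SK K).PosSemidef) (α : ι → ℕ) (β : κ → ℕ) (j : κ) :
    MK K α (β + Pi.single j 1) = ∑ i, K i j * (α i * MK K (α - Pi.single i 1) β) := by
  unfold MK
  rw [← sum_elim_add_single_inr, M_succ hS, Fintype.sum_sum_type]
  simp only [SK, Matrix.fromBlocks_apply₂₁, Matrix.fromBlocks_apply₂₂, Sum.elim_inl, Sum.elim_inr,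
    sum_elim_sub_single_inl, sum_elim_sub_single_inr, Matrix.one_apply, ite_mul, one_mul, zero_mul,
    Finset.sum_ite_eq, Finset.mem_univ, if_true, Matrix.transpose_apply]
  ring

omit [Fintype κ] [DecidableEq ι] [DecidableEq κ] in
/-- `M_K(0,0) = 1`. [folklore] -/
@[simp] private theorem MK_zero_zero (K : Matrix ι κ ℝ) [Fintype κ] [DecidableEq ι] [DecidableEq κ] :
    MK K 0 0 = 1 := by
  simp [MK, show Sum.elim (0 : ι → ℕ) (0 : κ → ℕ) = 0 from funext fun s => by cases s <;> rfl]

/-- A multi-index has degree `0` iff it is `0`. [folklore] -/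
private theorem deg_eq_zero_iff {τ : Type*} [Fintype τ] (α : τ → ℕ) : deg α = 0 ↔ α = 0 := by
  simp [deg, Finset.sum_eq_zero_iff, funext_iff]

/-- Removing one unit from a nonzero entry lowers the degree by one. [folklore] -/
private theorem deg_sub_single {τ : Type*} [Fintype τ] [DecidableEq τ] (α : τ → ℕ) (t : τ) (ht : α t ≠ 0) :
    deg (α - Pi.single t 1) + 1 = deg α := by
  have hα : α = (α - Pi.single t 1) + Pi.single t 1 := by
    funext s; by_cases hs : s = t
    · subst hs; simp; omega
    · simp [hs]
  unfold deg
  conv_rhs => rw [hα]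
  simp only [Pi.add_apply, Finset.sum_add_distrib, Finset.sum_pi_single', Finset.mem_univ, if_true]

/-- A multi-index of positive degree is a successor. [folklore] -/
private theorem exists_eq_add_single {τ : Type*} [Fintype τ] [DecidableEq τ] {α : τ → ℕ} {n : ℕ}
    (h : deg α = n + 1) : ∃ (t : τ) (α' : τ → ℕ), α = α' + Pi.single t 1 ∧ deg α' = n := by
  have hne : α ≠ 0 := fun h0 => by rw [(deg_eq_zero_iff α).2 h0] at h; omega
  obtain ⟨t, ht⟩ : ∃ t, α t ≠ 0 := by
    by_contra hcon
    simp only [not_exists, not_not] at hcon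
    exact hne (funext hcon)
  refine ⟨t, α - Pi.single t 1, ?_, ?_⟩
  · funext s
    by_cases hs : s = t
    · subst hs; simp; omega
    · simp [hs]
  · have := deg_sub_single α t ht
    omega

/-- **Chaos selection rule**: `E[H_α(ξ) H_β(η)] = 0` unless `|α| = |β|` (Wick products of different
orders are orthogonal, Janson 1997 Thm 3.9). [cite: Janson1997, Theorem 3.9] -/
theorem MK_eq_zero_of_deg_ne {K : Matrix ι κ ℝ} (hS : (SK K).PosSemidef) :
    ∀ (n : ℕ) (α : ι → ℕ) (β : κ → ℕ), deg α = n → deg β ≠ n → MK K α β = 0 := by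
  intro n
  induction n with
  | zero =>
    intro α β hα hβ
    rw [(deg_eq_zero_iff α).1 hα]
    obtain ⟨m, hm⟩ : ∃ m, deg β = m + 1 := ⟨deg β - 1, by omega⟩
    obtain ⟨j, β', rfl, -⟩ := exists_eq_add_single hm
    rw [MK_succ_inr hS]
    simp
  | succ n ih =>
    intro α β hα hβ
    obtain ⟨i, α', rfl, hα'⟩ := exists_eq_add_single hα
    rw [MK_succ_inl hS]
    refine Finset.sum_eq_zero fun j _ => ?_
    rcases Nat.eq_zero_or_pos (β j) with h0 | hpos
    · simp [h0]
    · have : deg (β - Pi.single j 1) ≠ n := by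
        have := deg_sub_single β j hpos.ne'
        omega
      rw [ih α' _ hα' this]; simp

/-- **Homogeneity in the cross-covariance**: `M_{cK}(α, β) = c^{|α|} M_K(α, β)` (the order-`n` chaos
component scales like `K^{⊗n}`, Janson 1997 Thm 3.9 / Thm 4.9). [cite: Janson1997, Theorem 3.9] -/
theorem MK_smul {K : Matrix ι κ ℝ} (c : ℝ) (hS : (SK K).PosSemidef) (hS' : (SK (c • K)).PosSemidef) :
    ∀ (n : ℕ) (α : ι → ℕ) (β : κ → ℕ), deg α = n → MK (c • K) α β = c ^ n * MK K α β := by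
  intro n
  induction n with
  | zero =>
    intro α β hα
    rw [(deg_eq_zero_iff α).1 hα]
    by_cases hβ : β = 0
    · subst hβ; simp
    · have hdβ : deg β ≠ 0 := fun h => hβ ((deg_eq_zero_iff β).1 h)
      rw [MK_eq_zero_of_deg_ne hS' 0 0 β (by simp [deg]) hdβ,
        MK_eq_zero_of_deg_ne hS 0 0 β (by simp [deg]) hdβ]
      simp
  | succ n ih =>
    intro α β hα
    obtain ⟨i, α', rfl, hα'⟩ := exists_eq_add_single hα
    rw [MK_succ_inl hS', MK_succ_inl hS, Finset.mul_sum]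
    refine Finset.sum_congr rfl fun j _ => ?_
    rw [ih α' _ hα', Matrix.smul_apply, smul_eq_mul]
    ring

end Block

/-! ### H. Marginals of `N(0,S)` on coordinate blocks; orthogonality on the diagonal blocks -/

section Marginal

variable {σ τ : Type*} [Fintype σ] [DecidableEq σ] [Fintype τ] [DecidableEq τ]

/-- Restriction of coordinates along `e : τ → σ` as a continuous linear map of Euclidean spaces. [folklore] -/
def restrictCLM (e : τ → σ) : EuclideanSpace ℝ σ →L[ℝ] EuclideanSpace ℝ τ :=
  (EuclideanSpace.equiv τ ℝ).symm.toContinuousLinearMap ∘L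
    (ContinuousLinearMap.pi fun t => EuclideanSpace.proj (e t))

omit [Fintype σ] [DecidableEq σ] [Fintype τ] [DecidableEq τ] in
/-- Coordinates of the restriction. [folklore] -/
@[simp] private theorem restrictCLM_apply (e : τ → σ) (z : EuclideanSpace ℝ σ) (t : τ) :
    restrictCLM e z t = z (e t) := rfl

/-- **Marginals of a multivariate Gaussian on a block of coordinates** are multivariate Gaussian with
the corresponding submatrix as covariance. [folklore] -/
private theorem map_restrictCLM_γm {S : Matrix σ σ ℝ} (hS : S.PosSemidef) (e : τ → σ) :
    (γm S).map (restrictCLM e) = γm (S.submatrix e e) := by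
  apply IsGaussian.ext
  · simp only [id_eq]
    rw [ContinuousLinearMap.integral_id_map IsGaussian.integrable_id]
    simp [γm]
  rw [← ContinuousLinearMap.toBilinForm_inj]
  refine LinearMap.BilinForm.ext_basis (EuclideanSpace.basisFun τ ℝ).toBasis fun i j => ?_
  rw [ContinuousLinearMap.toBilinForm_apply, ContinuousLinearMap.toBilinForm_apply,
    covarianceBilin_apply_eq_cov, covariance_map]
  · have (i : τ) : (fun u ↦ inner ℝ ((EuclideanSpace.basisFun τ ℝ).toBasis i) u) ∘
        restrictCLM e = fun u : EuclideanSpace ℝ σ => u (e i) := by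
      ext u; simp [PiLp.inner_apply]
    simp_rw [this, γm, covariance_eval_multivariateGaussian hS,
      covarianceBilin_multivariateGaussian (hS.submatrix _)]
    simp
  any_goals exact Measurable.aestronglyMeasurable (by fun_prop)
  · fun_prop
  · exact IsGaussian.memLp_two_id

/-- Integration of a function of a coordinate block. [folklore] -/
private theorem integral_comp_restrict_γm {S : Matrix σ σ ℝ} (hS : S.PosSemidef) (e : τ → σ)
    {Φ : (τ → ℝ) → ℝ} (hΦ : Measurable Φ) :
    ∫ z, Φ (fun t => z (e t)) ∂γm S = ∫ w, Φ (ofLp w) ∂γm (S.submatrix e e) := by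
  rw [← map_restrictCLM_γm hS e, integral_map (by fun_prop)]
  · rfl
  · exact (hΦ.comp (PiLp.continuous_ofLp 2 _).measurable).aestronglyMeasurable

omit [DecidableEq σ] in
/-- For the identity covariance, `N(0,1_σ)` is the product Gaussian. [folklore] -/
private theorem integral_γm_one [DecidableEq σ] {Φ : (σ → ℝ) → ℝ} (hΦ : Measurable Φ) :
    ∫ w, Φ (ofLp w) ∂γm (1 : Matrix σ σ ℝ) = ∫ x, Φ x ∂γπ σ := by
  have h := integral_γm_eq (1 : Matrix σ σ ℝ) (Φ := fun w => Φ (ofLp w))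
    (hΦ.comp (PiLp.continuous_ofLp 2 _).measurable)
  rw [h]
  simp [CFC.sqrt_one]

end Marginal

section BlockOrthogonality

variable {ι κ : Type*} [Fintype ι] [Fintype κ] [DecidableEq ι] [DecidableEq κ]

omit [Fintype ι] [Fintype κ] in
/-- The `ξξ` block of `[[1, K], [Kᵀ, 1]]` is `1`. [folklore] -/
private theorem SK_submatrix_inl (K : Matrix ι κ ℝ) : (SK K).submatrix Sum.inl Sum.inl = 1 := by
  ext i j; simp [SK]

omit [Fintype ι] [Fintype κ] in
/-- The `ηη` block of `[[1, K], [Kᵀ, 1]]` is `1`. [folklore] -/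
private theorem SK_submatrix_inr (K : Matrix ι κ ℝ) : (SK K).submatrix Sum.inr Sum.inr = 1 := by
  ext i j; simp [SK]

/-- Expectations of functions of `ξ` alone are product-Gaussian integrals. [folklore] -/
private theorem integral_inl_SK {K : Matrix ι κ ℝ} (hS : (SK K).PosSemidef) {Φ : (ι → ℝ) → ℝ}
    (hΦ : Measurable Φ) : ∫ z, Φ (fun i => z (Sum.inl i)) ∂γm (SK K) = ∫ x, Φ x ∂γπ ι := by
  rw [integral_comp_restrict_γm hS Sum.inl hΦ, SK_submatrix_inl, integral_γm_one hΦ]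

/-- Expectations of functions of `η` alone are product-Gaussian integrals. [folklore] -/
private theorem integral_inr_SK {K : Matrix ι κ ℝ} (hS : (SK K).PosSemidef) {Φ : (κ → ℝ) → ℝ}
    (hΦ : Measurable Φ) : ∫ z, Φ (fun j => z (Sum.inr j)) ∂γm (SK K) = ∫ x, Φ x ∂γπ κ := by
  rw [integral_comp_restrict_γm hS Sum.inr hΦ, SK_submatrix_inr, integral_γm_one hΦ]

/-- `α! = ∏ (α_i)!`. [folklore] -/
def mfact {τ : Type*} [Fintype τ] (α : τ → ℕ) : ℕ := ∏ t, (α t).factorial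

/-- Hermite functionals are measurable. [folklore] -/
private theorem measurable_hf {τ : Type*} [Fintype τ] (α : τ → ℕ) : Measurable (hf α) := by
  refine (continuous_finsetProd _ fun t _ => ?_).measurable
  exact (continuous_he _).comp (continuous_apply t)

/-- **Orthogonality of multivariate Hermite functionals** for the product Gaussian:
`∫ H_α H_α' dγ^{⊗τ} = α! δ_{αα'}` (`{(α!)^{-1/2} :ξ^α:}` is orthonormal, Janson 1997 Thm 3.21).
[cite: Janson1997, Theorem 3.21] -/
theorem integral_hf_mul_hf_pi {τ : Type*} [Fintype τ] [DecidableEq τ] (α α' : τ → ℕ) :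
    ∫ x, hf α x * hf α' x ∂γπ τ = if α = α' then (mfact α : ℝ) else 0 := by
  have h1 : ∀ x : τ → ℝ, hf α x * hf α' x = ∏ t, (he (α t) (x t) * he (α' t) (x t)) := by
    intro x; rw [hf, hf, ← Finset.prod_mul_distrib]
  simp_rw [h1]
  rw [integral_fintype_prod_eq_prod (𝕜 := ℝ) (fun t (y : ℝ) => he (α t) y * he (α' t) y)]
  simp_rw [integral_he_mul_he]
  by_cases h : α = α'
  · subst h; simp [mfact]
  · rw [if_neg h]
    obtain ⟨t, ht⟩ : ∃ t, α t ≠ α' t := by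
      by_contra hcon
      simp only [not_exists, not_not] at hcon
      exact h (funext hcon)
    exact Finset.prod_eq_zero (Finset.mem_univ t) (if_neg ht)

/-- Orthogonality in the `ξ`-block under the joint law. [cite: Janson1997, Theorem 3.21] -/
theorem integral_hf_inl_mul {K : Matrix ι κ ℝ} (hS : (SK K).PosSemidef) (α α' : ι → ℕ) :
    ∫ z, hf α (fun i => z (Sum.inl i)) * hf α' (fun i => z (Sum.inl i)) ∂γm (SK K) =
      if α = α' then (mfact α : ℝ) else 0 := by
  rw [← integral_hf_mul_hf_pi]
  exact integral_inl_SK hS (Φ := fun x => hf α x * hf α' x) ((measurable_hf α).mul (measurable_hf α'))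

/-- Orthogonality in the `η`-block under the joint law. [cite: Janson1997, Theorem 3.21] -/
theorem integral_hf_inr_mul {K : Matrix ι κ ℝ} (hS : (SK K).PosSemidef) (β β' : κ → ℕ) :
    ∫ z, hf β (fun j => z (Sum.inr j)) * hf β' (fun j => z (Sum.inr j)) ∂γm (SK K) =
      if β = β' then (mfact β : ℝ) else 0 := by
  rw [← integral_hf_mul_hf_pi]
  exact integral_inr_SK hS (Φ := fun x => hf β x * hf β' x) ((measurable_hf β).mul (measurable_hf β'))

omit [DecidableEq ι] [DecidableEq κ] in
/-- `H_{(α,β)}(ξ,η) = H_α(ξ) H_β(η)`. [folklore] -/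
private theorem hf_sum_elim (α : ι → ℕ) (β : κ → ℕ) (z : ι ⊕ κ → ℝ) :
    hf (Sum.elim α β) z = hf α (fun i => z (Sum.inl i)) * hf β (fun j => z (Sum.inr j)) := by
  simp [hf, Fintype.prod_sum_type]

/-- `M_K(α,β) = E[H_α(ξ) H_β(η)]`. [folklore] -/
private theorem MK_eq_integral (K : Matrix ι κ ℝ) (α : ι → ℕ) (β : κ → ℕ) :
    MK K α β = ∫ z, hf α (fun i => z (Sum.inl i)) * hf β (fun j => z (Sum.inr j)) ∂γm (SK K) := by
  simp only [MK, M, hf_sum_elim]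

end BlockOrthogonality

/-! ### I. Hermite expansion of polynomials; positivity of the block covariance; Cauchy–Schwarz -/

section Expansion

variable {τ : Type*} [Fintype τ] [DecidableEq τ]

/-- The linear span of the Hermite functionals `H_α`. [cite: Janson1997, Example 2.9] -/
def hermiteSpan (τ : Type*) [Fintype τ] : Submodule ℝ ((τ → ℝ) → ℝ) :=
  Submodule.span ℝ (Set.range (hf (σ := τ)))

/-- The span of the Hermite functionals is stable under multiplication by a coordinate. [cite: Janson1997, Example 3.18 (3.14)] -/
theorem coord_mul_mem_hermiteSpan (i : τ) {f : (τ → ℝ) → ℝ} (hmem : f ∈ hermiteSpan τ) :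
    (fun x => x i * f x) ∈ hermiteSpan τ := by
  induction hmem using Submodule.span_induction with
  | mem g hg =>
    obtain ⟨α, rfl⟩ := hg
    have : (fun x => x i * hf α x) = hf (α + Pi.single i 1) + (α i : ℝ) • hf (α - Pi.single i 1) := by
      funext x; simp [coord_mul_hf]
    rw [this]
    exact add_mem (Submodule.subset_span ⟨_, rfl⟩)
      (Submodule.smul_mem _ _ (Submodule.subset_span ⟨_, rfl⟩))
  | zero =>
    have : (fun x : τ → ℝ => x i * (0 : (τ → ℝ) → ℝ) x) = 0 := by funext x; simp
    rw [this]; exact zero_mem _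
  | add f g _ _ hf' hg' =>
    have : (fun x => x i * (f + g) x) = (fun x => x i * f x) + (fun x => x i * g x) := by
      funext x; simp [mul_add]
    rw [this]; exact add_mem hf' hg'
  | smul r f _ hf' =>
    have : (fun x => x i * (r • f) x) = r • (fun x => x i * f x) := by
      funext x; simp; ring
    rw [this]; exact Submodule.smul_mem _ _ hf'

/-- Every polynomial function lies in the span of the Hermite functionals (the `H_α` of degree
`≤ n` span the polynomials of degree `≤ n`, Janson 1997, Example 2.9 / Thm 2.6). [cite: Janson1997, Example 2.9] -/
theorem eval_mem_hermiteSpan (P : MvPolynomial τ ℝ) :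
    (fun x => MvPolynomial.eval x P) ∈ hermiteSpan τ := by
  induction P using MvPolynomial.induction_on with
  | C a =>
    have : (fun x : τ → ℝ => MvPolynomial.eval x (MvPolynomial.C a)) = a • hf (0 : τ → ℕ) := by
      funext x; simp
    rw [this]; exact Submodule.smul_mem _ _ (Submodule.subset_span ⟨_, rfl⟩)
  | add p q hp hq =>
    have : (fun x : τ → ℝ => MvPolynomial.eval x (p + q)) =
        (fun x => MvPolynomial.eval x p) + (fun x => MvPolynomial.eval x q) := by
      funext x; simp
    rw [this]; exact add_mem hp hq
  | mul_X p i hp =>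
    have : (fun x : τ → ℝ => MvPolynomial.eval x (p * MvPolynomial.X i)) =
        fun x => x i * MvPolynomial.eval x p := by
      funext x; simp [mul_comm]
    rw [this]; exact coord_mul_mem_hermiteSpan i hp

/-- **Hermite expansion**: a polynomial is a finite combination `P = ∑_α c_α H_α` (with `0` in the
index set, for convenience). [cite: Janson1997, Example 2.9] -/
theorem exists_hermite_expansion (P : MvPolynomial τ ℝ) :
    ∃ (A : Finset (τ → ℕ)) (c : (τ → ℕ) → ℝ), (0 : τ → ℕ) ∈ A ∧
      ∀ x, MvPolynomial.eval x P = ∑ α ∈ A, c α * hf α x := by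
  obtain ⟨c, hc⟩ := (Finsupp.mem_span_range_iff_exists_finsupp).1 (eval_mem_hermiteSpan P)
  refine ⟨insert 0 c.support, c, Finset.mem_insert_self _ _, fun x => ?_⟩
  have h := congrFun hc x
  simp only [Finsupp.sum, Finset.sum_apply, Pi.smul_apply, smul_eq_mul] at h
  rw [← h, Finset.sum_insert_of_eq_zero_if_notMem]
  intro h0
  simp [Finsupp.notMem_support_iff.1 h0]

end Expansion

section PSD

variable {ι κ : Type*} [Fintype ι] [Fintype κ] [DecidableEq ι] [DecidableEq κ]

/-- If `|uᵀ K v| ≤ |u| |v|` then `[[1, K], [Kᵀ, 1]]` is positive semidefinite. [folklore] -/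
private theorem posSemidef_SK {K : Matrix ι κ ℝ}
    (hK : ∀ (u : ι → ℝ) (v : κ → ℝ), |u ⬝ᵥ (K *ᵥ v)| ≤ Real.sqrt (u ⬝ᵥ u) * Real.sqrt (v ⬝ᵥ v)) :
    (SK K).PosSemidef := by
  refine Matrix.PosSemidef.of_dotProduct_mulVec_nonneg ?_ fun x => ?_
  · unfold SK
    exact Matrix.IsHermitian.fromBlocks Matrix.isHermitian_one
      (by rw [Matrix.conjTranspose_eq_transpose_of_trivial]) Matrix.isHermitian_one
  · have hx : x = Sum.elim (x ∘ Sum.inl) (x ∘ Sum.inr) := (Sum.elim_comp_inl_inr x).symm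
    set u := x ∘ Sum.inl
    set v := x ∘ Sum.inr
    rw [star_trivial, hx, SK, Matrix.fromBlocks_mulVec, Sum.elim_comp_inl, Sum.elim_comp_inr,
      sumElim_dotProduct_sumElim, Matrix.one_mulVec, Matrix.one_mulVec, dotProduct_add,
      dotProduct_add]
    have h1 : v ⬝ᵥ (Kᵀ *ᵥ u) = u ⬝ᵥ (K *ᵥ v) := by
      rw [Matrix.mulVec_transpose, Matrix.dotProduct_mulVec, dotProduct_comm]
    rw [h1]
    have h2 := hK u v
    have hu : 0 ≤ u ⬝ᵥ u := Finset.sum_nonneg fun i (_ : i ∈ Finset.univ) => mul_self_nonneg (u i)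
    have hv : 0 ≤ v ⬝ᵥ v := Finset.sum_nonneg fun i (_ : i ∈ Finset.univ) => mul_self_nonneg (v i)
    have h3 : -(Real.sqrt (u ⬝ᵥ u) * Real.sqrt (v ⬝ᵥ v)) ≤ u ⬝ᵥ (K *ᵥ v) := (abs_le.1 h2).1
    nlinarith [Real.mul_self_sqrt hu, Real.mul_self_sqrt hv, Real.sqrt_nonneg (u ⬝ᵥ u),
      Real.sqrt_nonneg (v ⬝ᵥ v), mul_self_nonneg (Real.sqrt (u ⬝ᵥ u) - Real.sqrt (v ⬝ᵥ v))]

omit [Fintype ι] [DecidableEq ι] [DecidableEq κ] in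
/-- Rescaling the hypothesis `|uᵀ K v| ≤ ρ |u| |v|`. [folklore] -/
private theorem rescale_bound {K : Matrix ι κ ℝ} {ρ : ℝ} [Fintype ι]
    (hK : ∀ (u : ι → ℝ) (v : κ → ℝ), |u ⬝ᵥ (K *ᵥ v)| ≤ ρ * Real.sqrt (u ⬝ᵥ u) * Real.sqrt (v ⬝ᵥ v)) :
    ∀ (u : ι → ℝ) (v : κ → ℝ),
      |u ⬝ᵥ ((if ρ = 0 then (0 : Matrix ι κ ℝ) else ρ⁻¹ • K) *ᵥ v)| ≤
        Real.sqrt (u ⬝ᵥ u) * Real.sqrt (v ⬝ᵥ v) := by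
  intro u v
  by_cases hρ : ρ = 0
  · simp [hρ]; positivity
  · rw [if_neg hρ, Matrix.smul_mulVec, dotProduct_smul, smul_eq_mul, abs_mul, abs_inv]
    have h := hK u v
    have hρ' : 0 < |ρ| := abs_pos.2 hρ
    rw [inv_mul_le_iff₀ hρ']
    calc |u ⬝ᵥ (K *ᵥ v)| ≤ ρ * Real.sqrt (u ⬝ᵥ u) * Real.sqrt (v ⬝ᵥ v) := h
      _ ≤ |ρ| * (Real.sqrt (u ⬝ᵥ u) * Real.sqrt (v ⬝ᵥ v)) := by
        rw [mul_assoc]; exact mul_le_mul_of_nonneg_right (le_abs_self ρ) (by positivity)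

end PSD

section CauchySchwarz

variable {Ω : Type*} [MeasurableSpace Ω] {μ : Measure Ω}

/-- Cauchy–Schwarz for integrals, discriminant form. [folklore] -/
private theorem abs_integral_mul_le_sqrt {X Y : Ω → ℝ} (hXY : Integrable (fun ω => X ω * Y ω) μ)
    (hX : Integrable (fun ω => X ω ^ 2) μ) (hY : Integrable (fun ω => Y ω ^ 2) μ) :
    |∫ ω, X ω * Y ω ∂μ| ≤ Real.sqrt (∫ ω, X ω ^ 2 ∂μ) * Real.sqrt (∫ ω, Y ω ^ 2 ∂μ) := by
  set a := ∫ ω, Y ω ^ 2 ∂μ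
  set b := ∫ ω, X ω * Y ω ∂μ
  set c := ∫ ω, X ω ^ 2 ∂μ
  have ha : 0 ≤ a := integral_nonneg fun ω => sq_nonneg _
  have hc : 0 ≤ c := integral_nonneg fun ω => sq_nonneg _
  have hquad : ∀ t : ℝ, 0 ≤ a * (t * t) + (-2 * b) * t + c := by
    intro t
    have h0 : 0 ≤ ∫ ω, (X ω - t * Y ω) ^ 2 ∂μ := integral_nonneg fun ω => sq_nonneg _
    have h1 : ∫ ω, (X ω - t * Y ω) ^ 2 ∂μ = c - 2 * t * b + t ^ 2 * a := by
      have e : ∀ ω, (X ω - t * Y ω) ^ 2 = X ω ^ 2 - 2 * t * (X ω * Y ω) + t ^ 2 * Y ω ^ 2 := by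
        intro ω; ring
      simp_rw [e]
      rw [integral_add, integral_sub hX (hXY.const_mul _), integral_const_mul, integral_const_mul]
      · exact hX.sub (hXY.const_mul _)
      · exact hY.const_mul _
    rw [h1] at h0
    nlinarith
  have hd := discrim_le_zero hquad
  rw [discrim] at hd
  have hb : b ^ 2 ≤ c * a := by nlinarith
  calc |b| = Real.sqrt (b ^ 2) := (Real.sqrt_sq_eq_abs b).symm
    _ ≤ Real.sqrt (c * a) := Real.sqrt_le_sqrt hb
    _ = Real.sqrt c * Real.sqrt a := Real.sqrt_mul hc a

end CauchySchwarz

/-! ### J. The maximal-correlation inequality for polynomial statistics -/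

section Main

variable {ι κ : Type*} [Fintype ι] [Fintype κ] [DecidableEq ι] [DecidableEq κ]

/-- The `ξ`-block of coordinates of `z ∈ ℝ^{ι ⊕ κ}`. [folklore] -/
abbrev xL (z : EuclideanSpace ℝ (ι ⊕ κ)) : ι → ℝ := fun i => z (Sum.inl i)

/-- The `η`-block of coordinates of `z ∈ ℝ^{ι ⊕ κ}`. [folklore] -/
abbrev xR (z : EuclideanSpace ℝ (ι ⊕ κ)) : κ → ℝ := fun j => z (Sum.inr j)

/-- A Hermite combination in `ξ` as a polynomial on the joint space. [folklore] -/
def hPL (S : Finset (ι → ℕ)) (a : (ι → ℕ) → ℝ) : MvPolynomial (ι ⊕ κ) ℝ :=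
  ∑ α ∈ S, MvPolynomial.C (a α) * MvPolynomial.rename Sum.inl (hP α)

/-- A Hermite combination in `η` as a polynomial on the joint space. [folklore] -/
def hPR (S : Finset (κ → ℕ)) (b : (κ → ℕ) → ℝ) : MvPolynomial (ι ⊕ κ) ℝ :=
  ∑ β ∈ S, MvPolynomial.C (b β) * MvPolynomial.rename Sum.inr (hP β)

omit [Fintype κ] [DecidableEq ι] [DecidableEq κ] in
/-- Evaluation of `hPL`. [folklore] -/
private theorem eval_hPL (S : Finset (ι → ℕ)) (a : (ι → ℕ) → ℝ) (z : EuclideanSpace ℝ (ι ⊕ κ)) :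
    MvPolynomial.eval (ofLp z) (hPL (κ := κ) S a) = ∑ α ∈ S, a α * hf α (xL z) := by
  simp only [hPL, map_sum, map_mul, MvPolynomial.eval_C, MvPolynomial.eval_rename, eval_hP]
  rfl

omit [Fintype ι] [DecidableEq ι] [DecidableEq κ] in
/-- Evaluation of `hPR`. [folklore] -/
private theorem eval_hPR (S : Finset (κ → ℕ)) (b : (κ → ℕ) → ℝ) (z : EuclideanSpace ℝ (ι ⊕ κ)) :
    MvPolynomial.eval (ofLp z) (hPR (ι := ι) S b) = ∑ β ∈ S, b β * hf β (xR z) := by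
  simp only [hPR, map_sum, map_mul, MvPolynomial.eval_C, MvPolynomial.eval_rename, eval_hP]
  rfl

/-- `E[(∑ a_α H_α(ξ)) (∑ b_β H_β(η))] = ∑∑ a_α b_β M_K(α, β)`. [folklore] -/
private theorem integral_sumL_mul_sumR (K : Matrix ι κ ℝ) (S : Finset (ι → ℕ)) (T : Finset (κ → ℕ))
    (a : (ι → ℕ) → ℝ) (b : (κ → ℕ) → ℝ) :
    ∫ z, (∑ α ∈ S, a α * hf α (xL z)) * (∑ β ∈ T, b β * hf β (xR z)) ∂γm (SK K) =
      ∑ α ∈ S, ∑ β ∈ T, a α * b β * MK K α β := by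
  have h1 : ∀ z : EuclideanSpace ℝ (ι ⊕ κ), (∑ α ∈ S, a α * hf α (xL z)) * (∑ β ∈ T, b β * hf β (xR z)) =
      ∑ α ∈ S, ∑ β ∈ T, a α * b β * (hf α (xL z) * hf β (xR z)) := by
    intro z
    rw [Finset.sum_mul_sum]
    exact Finset.sum_congr rfl fun α _ => Finset.sum_congr rfl fun β _ => by ring
  simp_rw [h1]
  rw [integral_finsetSum _ fun α _ => ?_]
  · refine Finset.sum_congr rfl fun α _ => ?_
    rw [integral_finsetSum _ fun β _ => ?_]
    · refine Finset.sum_congr rfl fun β _ => ?_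
      rw [integral_const_mul, MK_eq_integral]
    · refine Integrable.const_mul ?_ _
      simpa [hf_sum_elim] using integrable_hf (SK K) (Sum.elim α β)
  · refine integrable_finsetSum _ fun β _ => Integrable.const_mul ?_ _
    simpa [hf_sum_elim] using integrable_hf (SK K) (Sum.elim α β)

/-- `E[(∑ a_α H_α(ξ)) (∑ a'_α H_α(ξ))] = ∑ a_α a'_α α!`. [cite: Janson1997, Theorem 3.21] -/
theorem integral_sumL_mul_sumL {K : Matrix ι κ ℝ} (hS : (SK K).PosSemidef) (S : Finset (ι → ℕ))
    (a a' : (ι → ℕ) → ℝ) :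
    ∫ z, (∑ α ∈ S, a α * hf α (xL z)) * (∑ α ∈ S, a' α * hf α (xL z)) ∂γm (SK K) =
      ∑ α ∈ S, a α * a' α * mfact α := by
  have h1 : ∀ z : EuclideanSpace ℝ (ι ⊕ κ), (∑ α ∈ S, a α * hf α (xL z)) * (∑ α ∈ S, a' α * hf α (xL z)) =
      ∑ α ∈ S, ∑ α' ∈ S, a α * a' α' * (hf α (xL z) * hf α' (xL z)) := by
    intro z
    rw [Finset.sum_mul_sum]
    exact Finset.sum_congr rfl fun α _ => Finset.sum_congr rfl fun β _ => by ring
  simp_rw [h1]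
  have hint : ∀ α α' : ι → ℕ,
      Integrable (fun z : EuclideanSpace ℝ (ι ⊕ κ) => hf α (xL z) * hf α' (xL z)) (γm (SK K)) := by
    intro α α'
    have := integrable_eval_γm (SK K)
      (MvPolynomial.rename Sum.inl (hP α) * MvPolynomial.rename Sum.inl (hP α'))
    refine this.congr (ae_of_all _ fun z => ?_)
    simp only [map_mul, MvPolynomial.eval_rename, eval_hP]
    rfl
  rw [integral_finsetSum _ fun α _ => ?_]
  · refine Finset.sum_congr rfl fun α hα => ?_
    rw [integral_finsetSum _ fun β _ => (hint _ _).const_mul _]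
    simp_rw [integral_const_mul, integral_hf_inl_mul hS, mul_ite, mul_zero]
    rw [Finset.sum_ite_eq]
    simp [hα]
  · exact integrable_finsetSum _ fun β _ => (hint _ _).const_mul _

/-- `E[(∑ b_β H_β(η)) (∑ b'_β H_β(η))] = ∑ b_β b'_β β!`. [cite: Janson1997, Theorem 3.21] -/
theorem integral_sumR_mul_sumR {K : Matrix ι κ ℝ} (hS : (SK K).PosSemidef) (T : Finset (κ → ℕ))
    (b b' : (κ → ℕ) → ℝ) :
    ∫ z, (∑ β ∈ T, b β * hf β (xR z)) * (∑ β ∈ T, b' β * hf β (xR z)) ∂γm (SK K) =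
      ∑ β ∈ T, b β * b' β * mfact β := by
  have h1 : ∀ z : EuclideanSpace ℝ (ι ⊕ κ), (∑ β ∈ T, b β * hf β (xR z)) * (∑ β ∈ T, b' β * hf β (xR z)) =
      ∑ β ∈ T, ∑ β' ∈ T, b β * b' β' * (hf β (xR z) * hf β' (xR z)) := by
    intro z
    rw [Finset.sum_mul_sum]
    exact Finset.sum_congr rfl fun α _ => Finset.sum_congr rfl fun β _ => by ring
  simp_rw [h1]
  have hint : ∀ β β' : κ → ℕ,
      Integrable (fun z : EuclideanSpace ℝ (ι ⊕ κ) => hf β (xR z) * hf β' (xR z)) (γm (SK K)) := by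
    intro β β'
    have := integrable_eval_γm (SK K)
      (MvPolynomial.rename Sum.inr (hP β) * MvPolynomial.rename Sum.inr (hP β'))
    refine this.congr (ae_of_all _ fun z => ?_)
    simp only [map_mul, MvPolynomial.eval_rename, eval_hP]
    rfl
  rw [integral_finsetSum _ fun β _ => ?_]
  · refine Finset.sum_congr rfl fun β hβ => ?_
    rw [integral_finsetSum _ fun β' _ => (hint _ _).const_mul _]
    simp_rw [integral_const_mul, integral_hf_inr_mul hS, mul_ite, mul_zero]
    rw [Finset.sum_ite_eq]
    simp [hβ]
  · exact integrable_finsetSum _ fun β' _ => (hint _ _).const_mul _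

/-- `M_K(α, 0) = δ_{α0}` (Wick products have mean zero). [cite: Janson1997, Theorem 3.9] -/
theorem MK_zero_right {K : Matrix ι κ ℝ} (hS : (SK K).PosSemidef) (α : ι → ℕ) :
    MK K α 0 = if α = 0 then 1 else 0 := by
  by_cases h : α = 0
  · subst h; simp
  · rw [if_neg h]
    have hd : deg α ≠ 0 := fun h0 => h ((deg_eq_zero_iff α).1 h0)
    exact MK_eq_zero_of_deg_ne hS (deg α) α 0 rfl (by simpa [deg] using hd.symm)

/-- `M_K(0, β) = δ_{β0}` (Wick products have mean zero). [cite: Janson1997, Theorem 3.9] -/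
theorem MK_zero_left {K : Matrix ι κ ℝ} (hS : (SK K).PosSemidef) (β : κ → ℕ) :
    MK K 0 β = if β = 0 then 1 else 0 := by
  by_cases h : β = 0
  · subst h; simp
  · rw [if_neg h]
    have hd : deg β ≠ 0 := fun h0 => h ((deg_eq_zero_iff β).1 h0)
    exact MK_eq_zero_of_deg_ne hS 0 0 β (by simp [deg]) hd

/-- `E[∑ a_α H_α(ξ)] = a_0` (when `0 ∈ S`). [folklore] -/
private theorem integral_sumL {K : Matrix ι κ ℝ} (hS : (SK K).PosSemidef) (S : Finset (ι → ℕ))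
    (a : (ι → ℕ) → ℝ) (h0 : (0 : ι → ℕ) ∈ S) :
    ∫ z, ∑ α ∈ S, a α * hf α (xL z) ∂γm (SK K) = a 0 := by
  have := integral_sumL_mul_sumR K S {0} a (fun _ => 1)
  simp only [Finset.sum_singleton, hf_zero, mul_one, one_mul] at this
  rw [this]
  simp_rw [MK_zero_right hS, mul_ite, mul_one, mul_zero]
  rw [Finset.sum_ite_eq' S 0]
  simp [h0]

/-- `E[∑ b_β H_β(η)] = b_0` (when `0 ∈ T`). [folklore] -/
private theorem integral_sumR {K : Matrix ι κ ℝ} (hS : (SK K).PosSemidef) (T : Finset (κ → ℕ))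
    (b : (κ → ℕ) → ℝ) (h0 : (0 : κ → ℕ) ∈ T) :
    ∫ z, ∑ β ∈ T, b β * hf β (xR z) ∂γm (SK K) = b 0 := by
  have := integral_sumL_mul_sumR K {0} T (fun _ => 1) b
  simp only [Finset.sum_singleton, hf_zero, one_mul] at this
  rw [this]
  simp_rw [MK_zero_left hS, mul_ite, mul_one, mul_zero]
  rw [Finset.sum_ite_eq' T 0]
  simp [h0]

/-- **Gaussian maximal correlation = linear (canonical) correlation, polynomial form**
(Kolmogorov–Rozanov; Janson 1997, Thm 10.11: `ρ(H, K) = ρ₁(H, K) = ‖P_{HK}‖`). Let `(ξ, η)` be a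
centred Gaussian vector in `ℝ^ι × ℝ^κ` with `E ξξᵀ = 1`, `E ηηᵀ = 1` and cross-covariance
`E ξηᵀ = K` such that `|uᵀ K v| ≤ ρ |u| |v|` for all `u, v` (`0 ≤ ρ ≤ 1`), realised as the coordinate
blocks of `N(0, [[1, K], [Kᵀ, 1]])` on `ℝ^{ι ⊕ κ}`. Then for all real polynomials `P` on `ℝ^ι` and `Q`
on `ℝ^κ`: `|Cov(P(ξ), Q(η))| ≤ ρ · SD(P(ξ)) · SD(Q(η))`.
-- TODO(general form): all `L²` functionals of `ξ`, `η` (density of polynomials, Janson Thm 2.11) and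
-- closed subspaces of an arbitrary Gaussian Hilbert space (Janson Thm 10.11 verbatim).
[cite: Janson1997, Theorem 10.11] -/
theorem abs_covariance_polynomial_le {K : Matrix ι κ ℝ} {ρ : ℝ} (hρ0 : 0 ≤ ρ) (hρ1 : ρ ≤ 1)
    (hK : ∀ (u : ι → ℝ) (v : κ → ℝ), |u ⬝ᵥ (K *ᵥ v)| ≤ ρ * Real.sqrt (u ⬝ᵥ u) * Real.sqrt (v ⬝ᵥ v))
    (P : MvPolynomial ι ℝ) (Q : MvPolynomial κ ℝ) :
    |cov[fun z => MvPolynomial.eval (xL z) P, fun z => MvPolynomial.eval (xR z) Q; γm (SK K)]| ≤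
      ρ * Real.sqrt Var[fun z => MvPolynomial.eval (xL z) P; γm (SK K)] *
        Real.sqrt Var[fun z => MvPolynomial.eval (xR z) Q; γm (SK K)] := by
  -- positivity of the covariances of the pair and of the comparison pair `K' = K / ρ`
  have hK1 : ∀ (u : ι → ℝ) (v : κ → ℝ), |u ⬝ᵥ (K *ᵥ v)| ≤ Real.sqrt (u ⬝ᵥ u) * Real.sqrt (v ⬝ᵥ v) :=
    fun u v => (hK u v).trans (by
      rw [mul_assoc]; exact mul_le_of_le_one_left (by positivity) hρ1)
  have hS : (SK K).PosSemidef := posSemidef_SK hK1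
  set K' : Matrix ι κ ℝ := if ρ = 0 then 0 else ρ⁻¹ • K with hK'def
  have hS' : (SK K').PosSemidef := posSemidef_SK (rescale_bound hK)
  have hKK' : K = ρ • K' := by
    by_cases hρ : ρ = 0
    · rw [hK'def, if_pos hρ, smul_zero]
      ext i j
      have h := hK (Pi.single i 1) (Pi.single j 1)
      rw [hρ, zero_mul, zero_mul, abs_nonpos_iff] at h
      simpa [Matrix.mulVec, dotProduct, Pi.single_apply] using h
    · rw [hK'def, if_neg hρ, smul_smul, mul_inv_cancel₀ hρ, one_smul]
  have hSρ : (SK (ρ • K')).PosSemidef := hKK' ▸ hS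
  -- Hermite expansions
  obtain ⟨A, c, h0A, hP⟩ := exists_hermite_expansion P
  obtain ⟨B, d, h0B, hQ⟩ := exists_hermite_expansion Q
  set μ := γm (SK K) with hμ
  have hX : (fun z : EuclideanSpace ℝ (ι ⊕ κ) => MvPolynomial.eval (xL z) P) =
      fun z => ∑ α ∈ A, c α * hf α (xL z) := funext fun z => hP _
  have hY : (fun z : EuclideanSpace ℝ (ι ⊕ κ) => MvPolynomial.eval (xR z) Q) =
      fun z => ∑ β ∈ B, d β * hf β (xR z) := funext fun z => hQ _
  -- square integrability (polynomial functionals)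
  have hpolyL : ∀ z : EuclideanSpace ℝ (ι ⊕ κ), ∑ α ∈ A, c α * hf α (xL z) =
      MvPolynomial.eval (ofLp z) (hPL (κ := κ) A c) := fun z => (eval_hPL A c z).symm
  have hpolyR : ∀ z : EuclideanSpace ℝ (ι ⊕ κ), ∑ β ∈ B, d β * hf β (xR z) =
      MvPolynomial.eval (ofLp z) (hPR (ι := ι) B d) := fun z => (eval_hPR B d z).symm
  have hmemL : MemLp (fun z : EuclideanSpace ℝ (ι ⊕ κ) => ∑ α ∈ A, c α * hf α (xL z)) 2 μ := by
    rw [memLp_two_iff_integrable_sq]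
    · simp_rw [hpolyL, pow_two]
      simpa [map_mul] using integrable_eval_γm (SK K) (hPL (κ := κ) A c * hPL (κ := κ) A c)
    · simp_rw [hpolyL]; exact (measurable_eval_ofLp _).aestronglyMeasurable
  have hmemR : MemLp (fun z : EuclideanSpace ℝ (ι ⊕ κ) => ∑ β ∈ B, d β * hf β (xR z)) 2 μ := by
    rw [memLp_two_iff_integrable_sq]
    · simp_rw [hpolyR, pow_two]
      simpa [map_mul] using integrable_eval_γm (SK K) (hPR (ι := ι) B d * hPR (ι := ι) B d)
    · simp_rw [hpolyR]; exact (measurable_eval_ofLp _).aestronglyMeasurable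
  -- the covariance and the variances in terms of Hermite coefficients
  have hcov : cov[fun z => MvPolynomial.eval (xL z) P, fun z => MvPolynomial.eval (xR z) Q; μ] =
      ∑ α ∈ A.erase 0, ∑ β ∈ B.erase 0, c α * d β * MK K α β := by
    rw [hX, hY, covariance_eq_sub hmemL hmemR]
    simp only [Pi.mul_apply]
    rw [integral_sumL_mul_sumR, integral_sumL hS A c h0A, integral_sumR hS B d h0B]
    -- peel off the index `0` in both sums
    rw [← Finset.add_sum_erase A _ h0A, ← Finset.add_sum_erase B _ h0B]
    simp_rw [← Finset.add_sum_erase B _ h0B]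
    rw [Finset.sum_add_distrib]
    have h1 : ∑ β ∈ B.erase 0, c 0 * d β * MK K 0 β = 0 := by
      refine Finset.sum_eq_zero fun β hβ => ?_
      rw [MK_zero_left hS, if_neg (Finset.ne_of_mem_erase hβ), mul_zero]
    have h2 : ∑ α ∈ A.erase 0, c α * d 0 * MK K α 0 = 0 := by
      refine Finset.sum_eq_zero fun α hα => ?_
      rw [MK_zero_right hS, if_neg (Finset.ne_of_mem_erase hα), mul_zero]
    rw [h1, h2, MK_zero_zero]
    ring
  have hvarL : Var[fun z => MvPolynomial.eval (xL z) P; μ] = ∑ α ∈ A.erase 0, c α ^ 2 * mfact α := by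
    rw [hX, variance_eq_sub hmemL]
    simp only [Pi.pow_apply, pow_two]
    rw [integral_sumL_mul_sumL hS, integral_sumL hS A c h0A, Finset.sum_erase_eq_sub h0A]
    simp [mfact]
  have hvarR : Var[fun z => MvPolynomial.eval (xR z) Q; μ] = ∑ β ∈ B.erase 0, d β ^ 2 * mfact β := by
    rw [hY, variance_eq_sub hmemR]
    simp only [Pi.pow_apply, pow_two]
    rw [integral_sumR_mul_sumR hS, integral_sumR hS B d h0B, Finset.sum_erase_eq_sub h0B]
    simp [mfact]
  -- move to the comparison pair: `M_K(α,β) = ρ^{|α|} M_{K'}(α,β)`, `|α| ≥ 1`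
  set c' : (ι → ℕ) → ℝ := fun α => ρ ^ (deg α - 1) * c α with hc'
  have hcov' : cov[fun z => MvPolynomial.eval (xL z) P, fun z => MvPolynomial.eval (xR z) Q; μ] =
      ρ * ∫ z, (∑ α ∈ A.erase 0, c' α * hf α (xL z)) * (∑ β ∈ B.erase 0, d β * hf β (xR z))
        ∂γm (SK K') := by
    rw [hcov, integral_sumL_mul_sumR, Finset.mul_sum]
    refine Finset.sum_congr rfl fun α hα => ?_
    rw [Finset.mul_sum]
    refine Finset.sum_congr rfl fun β _ => ?_
    have hdeg : 1 ≤ deg α := by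
      have : deg α ≠ 0 := fun h0 => Finset.ne_of_mem_erase hα ((deg_eq_zero_iff α).1 h0)
      omega
    have hM : MK K α β = ρ ^ deg α * MK K' α β := by
      rw [hKK']; exact MK_smul ρ hS' hSρ (deg α) α β rfl
    rw [hM, show deg α = (deg α - 1) + 1 by omega, pow_succ]
    simp only [hc']
    ring
  -- Cauchy–Schwarz for the comparison pair
  have hint : ∀ G : MvPolynomial (ι ⊕ κ) ℝ,
      Integrable (fun z : EuclideanSpace ℝ (ι ⊕ κ) => MvPolynomial.eval (ofLp z) G) (γm (SK K')) :=
    fun G => integrable_eval_γm _ G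
  have hCS := abs_integral_mul_le_sqrt (μ := γm (SK K'))
    (X := fun z => ∑ α ∈ A.erase 0, c' α * hf α (xL z))
    (Y := fun z => ∑ β ∈ B.erase 0, d β * hf β (xR z))
    (by simpa [eval_hPL, eval_hPR, map_mul] using hint (hPL (κ := κ) (A.erase 0) c' * hPR (ι := ι) (B.erase 0) d))
    (by simpa [eval_hPL, map_mul, pow_two] using hint (hPL (κ := κ) (A.erase 0) c' * hPL (κ := κ) (A.erase 0) c'))
    (by simpa [eval_hPR, map_mul, pow_two] using hint (hPR (ι := ι) (B.erase 0) d * hPR (ι := ι) (B.erase 0) d))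
  simp only [pow_two] at hCS
  rw [integral_sumL_mul_sumL hS', integral_sumR_mul_sumR hS'] at hCS
  -- compare `∑ (c'_α)² α! ≤ ∑ c_α² α!`
  have hc'le : ∑ α ∈ A.erase 0, c' α * c' α * mfact α ≤ ∑ α ∈ A.erase 0, c α ^ 2 * mfact α := by
    refine Finset.sum_le_sum fun α _ => ?_
    rw [hc']
    have hρp : ρ ^ (deg α - 1) * ρ ^ (deg α - 1) ≤ 1 := by
      rw [← pow_two]; exact pow_le_one₀ (by positivity) (pow_le_one₀ hρ0 hρ1)
    have hm : (0 : ℝ) ≤ mfact α := by positivity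
    nlinarith [sq_nonneg (c α), mul_nonneg (mul_nonneg (sq_nonneg (c α)) hm) (sub_nonneg.2 hρp)]
  rw [hcov', hvarL, hvarR, abs_mul, abs_of_nonneg hρ0, mul_assoc]
  refine mul_le_mul_of_nonneg_left (hCS.trans ?_) hρ0
  gcongr
  · simp_rw [pow_two]; exact le_rfl

end Main

end GaussianHermite

end Literature.Probability.Distributions
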